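import Mathlib
import Summits.ValiantsHypothesis.ValiantsHypothesis.Theses.KPlusLogSqLaw
import Summits.ValiantsHypothesis.ValiantsHypothesis.Theorems.LacunarySymmetroidMatrixDescartesCensusTropicalKLaw
import Summits.ValiantsHypothesis.ValiantsHypothesis.Theorems.KPlusLogSqLawWeakLiftingBridge
import Summits.ValiantsHypothesis.ValiantsHypothesis.Theorems.KPlusLogSqLawValuativeDoorRankOneDomCount
import Summits.ValiantsHypothesis.ValiantsHypothesis.Theorems.KPlusLogSqLawValuativeDoorConvexRung
import Summits.ValiantsHypothesis.ValiantsHypothesis.Theorems.KPlusLogSqLawValuativeDoorSymmetryVoid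
import Summits.ValiantsHypothesis.ValiantsHypothesis.Theorems.KPlusLogSqLawValuativeDoorPencilTransferPoly
import Summits.ValiantsHypothesis.ValiantsHypothesis.Theorems.KPlusLogSqLawValuativeDoorTwoAdicOnReals
import Summits.ValiantsHypothesis.ValiantsHypothesis.Theorems.KPlusLogSqLawValuativeDoorCongruence
import Summits.ValiantsHypothesis.ValiantsHypothesis.Theorems.KPlusLogSqLawValuativeDoorThetaWitness
import Summits.ValiantsHypothesis.ValiantsHypothesis.Theorems.KPlusLogSqLawValuativeDoorRankOneSharp
import Summits.ValiantsHypothesis.ValiantsHypothesis.Theorems.KPlusLogSqLawValuativeDoorRankOneLawToMDR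
import Summits.ValiantsHypothesis.ValiantsHypothesis.Theorems.KPlusLogSqLawValuativeDoorRankOneLawFalse
import Summits.ValiantsHypothesis.ValiantsHypothesis.Theorems.KPlusLogSqLawValuativeDoorTwoFourCalibration
import Summits.ValiantsHypothesis.ValiantsHypothesis.Theorems.KPlusLogSqLawValuativeDoorSectors
import Summits.ValiantsHypothesis.ValiantsHypothesis.Theorems.KPlusLogSqLawValuativeDoorSidonTwo
import Summits.ValiantsHypothesis.ValiantsHypothesis.Theorems.KPlusLogSqLawValuativeDoorGenTwoSidon
import Summits.ValiantsHypothesis.ValiantsHypothesis.Theorems.KPlusLogSqLawValuativeDoorSidonTwoSharp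
import Summits.ValiantsHypothesis.ValiantsHypothesis.Theorems.KPlusLogSqLawValuativeDoorNewtonPolygon
import Summits.ValiantsHypothesis.ValiantsHypothesis.Theorems.KPlusLogSqLawValuativeDoorGenTwoUnitTwoLaw
import Summits.ValiantsHypothesis.ValiantsHypothesis.Theorems.KPlusLogSqLawValuativeDoorGenTwoSharp
import Summits.ValiantsHypothesis.ValiantsHypothesis.Theorems.KPlusLogSqLawValuativeDoorNonSidonWitness
import Summits.ValiantsHypothesis.ValiantsHypothesis.Theorems.KPlusLogSqLawValuativeDoorProgressionFree
import Summits.ValiantsHypothesis.ValiantsHypothesis.Theorems.KPlusLogSqLawValuativeDoorFGPlusOne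
import Summits.ValiantsHypothesis.ValiantsHypothesis.Theorems.KPlusLogSqLawValuativeDoorFGPlusOneSidon
import Summits.ValiantsHypothesis.ValiantsHypothesis.Theorems.KPlusLogSqLawValuativeDoorCoincidenceFree
import Summits.ValiantsHypothesis.ValiantsHypothesis.Theorems.KPlusLogSqLawValuativeDoorProgressionFreePoly
import Summits.ValiantsHypothesis.ValiantsHypothesis.Theorems.KPlusLogSqLawValuativeDoorAPFreeLaw
import Summits.ValiantsHypothesis.ValiantsHypothesis.Theorems.KPlusLogSqLawValuativeDoorTameLaw

/-!
# LINE `valuative_door` — SKELETON rev 2 (= rev 1 @daf645a8c83d + the registered target `ValDoorCloses`; crux `WeakLifting` = stmt-ValiantsHypothesis-19561; val-idea-24 g3; critic of record val-idea-crit-6)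

Declared LINE-ELIGIBLE by val-idea-crit-6 g4 VERDICT #56 (2026-08-29, desk R3003 condition) on the crux-idea card
`Cruxes/WeakLifting/Ideas/valuative-door.md` rev 3; line card `Cruxes/WeakLifting/Lines/valuative_door.md`.  Defs ll. «valuative
currency» … `ValTwoFourCalibration` are BYTE-IDENTICAL to the card's Sketch rev 3 (`HOME/ideators/val-idea-24/g3/ValDoorSketch.lean`
693e86fa8d6ed28c, ll. 35–154) so the critic's probes transfer (price L3).  JOINT THEOREMS (price L1, kernel, no further hypothesis):
`weakLifting_route_closes_val : TropicalB → ValWeakLifting → PencilTransferPoly → ValThetaWitness → TwoAdicOnReals → ValiantsHypothesis`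
and the sign-free `weakLifting_route_closes_valU : CombB → ValLiftingU → PencilTransferPoly → ValThetaWitness → TwoAdicOnReals →
ValiantsHypothesis`.  REGISTERED STUBS (price L2, five): `stub_pencilTransferPoly` [δ, S] · `stub_valThetaWitness` [M]+[S] ·
`stub_twoAdicOnReals` [M] · `stub_symmetryVoid` [S] · `stub_valRankOneSharpInj` [CALIBRATION; skeleton rev 6, was `stub_valRankOneLaw`, see «Skeleton rev 6» below].  The transferred crux vW (`ValWeakLifting`)
is a HYPOTHESIS of the joint theorem, not a stub (it is the line's form of the crux; incomparable with `WeakLifting`).  CALIBRATION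
TARGETS (for `Theorems/…` files, NOT stubs): `ValTwoFourCalibration`, `ValCongruenceLemma`, `ValRankOneSharp`, `ValRankOneSharpModular`
(conjectured for general `d`), `ValRankOneSharpModularDiss` (proved on paper; first target).
CLAIM TO BE PROVED IN THE FIRST HELPER FILE (used silently by every prose argument): for `v` non-archimedean and `f ≠ 0`,
`domCount v f` = number of vertices of the Newton polygon of `f` and `npEdges v f` = number of its edges = number of distinct values of
`v` on the roots of `f` in an algebraic closure when `f(0) ≠ 0`.

The NON-ARCHIMEDEAN door: count DOMINANT EXPONENTS of the lacunary determinant with respect to a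
non-archimedean absolute value (vertices of its Newton polygon = 1 + number of distinct absolute values of
its roots in an algebraic closure) instead of distinct REAL zeros.  All `Prop`s are candidates, never
asserted; the door compositions are PROVED (kernel glue only).  Nothing here proves `WeakLifting`, `TropicalB`,
Conjecture B, `MatrixDescartes` or VP ≠ VNP; vW / vU / vB / `ValRankOneLaw` are candidates implied by nothing known.

## Skeleton rev 6 (pen val-idea-24 g4, 2026-08-29; desk R3083 on crit-6 VERDICT #63 + the pen finding 07:34:17Z) — CUSTODY WORD

`ValRankOneLaw` AS TYPED (all `d`, repeated exponents allowed) is LOCATED-FALSE on paper (and with it `ValRankOneSharp` as typed):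
repeats = universality (lift-p1 g22 #8: over char 0 every symmetric letter is a sum of rank-one letters sharing its exponent, so the
law is a POLYNOMIAL valuative root law for ALL symmetric pencils) + the READ-ONCE BIPARTITE EMBEDDING of the tree's Carstensen theorem
`Literature.Combinatorics.Optimization.ParamDAG.exists_superpolynomial_isBreakpoint_natSlope` (`A_uv = 2^{a_e} X^{b_e}` on the arcs of the
layered DAG, `A_ts = 1`, unit loops elsewhere; `F = fromBlocks 0 A Aᵀ 0` symmetric, `det F = ± (det A)²`, `det A = ± Σ_paths 2^{a(P)} X^{b(P)}`;
2-adically `domCount` = number of parametric shortest-path pieces, superpolynomial in `m = 2N`, while the budgets `(mK)^C`, `m(K−m)` with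
`K ≤ 2m²` rank-one letters are polynomial) — write-up `HOME/ideators/val-idea-24/g4/VALRANKONE-REFUTED-g4.md` (041744a750c9db50); the Lean
refutation `not_valRankOneLaw` / `not_valRankOneSharp` is a `Theorems/…` LANE (desk R3083 (5)), booked only on ACCEPT.  What is TRUE is the
INJECTIVE-exponent law `ValRankOneSharpInj` (matroid exchange; lift-p1 g22 #7 `valRankOneSharpInj_unfolded`, kernel on its pre-image), to
which the last open stub is RE-TYPED below: a CALIBRATION statement that FEEDS NOTHING.  Hence, as of rev 6: **LINE (V) = the sorry-free
door `ValiantsHypothesis ⟸ TropicalB ∧ vW` (`valDoorCloses_skeleton`; both hypotheses OPEN; vW unregistered, incomparable with `WeakLifting`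
as typed) + kernel / calibration stubs, and NO CONTENT STUB — a conditional bridge, not a decomposition; it credits nothing toward
stmt-19561 / stmt-19771 / the summit.**  The two defs `ValRankOneLaw`, `ValRankOneSharp` stay byte-identical as the line's located NEGATIVE
statements.  Not threatened by the embedding (pen's paper check, critic to confirm): `ValKLaw`, `CombB`, `TropicalB` (format laws: the
staircases sit inside at `2^{Θ(log² m)}`), `ValMatrixDescartes` (regime `m ≤ 2^{(log₂ K + c)^c}`), vW / vU (hypothesis count = the same
staircase).  Located bridge (prose only, line card): the K-free READ-ONCE rung «npEdges(det of a monomial-entry matrix) ≤ 2^{C log² m}» is,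
by the same embedding on perfect matchings, ¬`DivisionGap.ShadowBirkhoff` (stmt-5069, HY21 Open Problem 1) up to constants.  VP ≠ VNP is
NOT proved by any of this.
-/

set_option linter.dupNamespace false

noncomputable section

open Classical

namespace Summit.ValiantsHypothesis.ValiantsHypothesis.Cruxes.WeakLifting.ValDoor

open Polynomial Finset
open scoped BigOperators
open Summit.ValiantsHypothesis.ValiantsHypothesis.Theses.LacunarySymmetroid (PencilTransfer)
open Summit.ValiantsHypothesis.ValiantsHypothesis.Theses.KPlusLogSqLaw (TropicalB)
open Summit.ValiantsHypothesis.ValiantsHypothesis.Theorems.LacunarySymmetroidMatrixDescartes.TropicalCensus (TropRootLawAt)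

/-! ## The valuative currency -/

/-- number of DOMINANT EXPONENTS of `f` for the absolute value `v`: exponents `E` of the support whose term
strictly dominates every other term at some radius `r > 0`.  For non-archimedean `v` and `f ≠ 0` this is the
number of vertices of the Newton polygon of `f` w.r.t. `v`. [definition of the card] -/
def domCount {F : Type} [Field F] (v : AbsoluteValue F ℝ) (f : Polynomial F) : ℕ :=
  (f.support.filter fun E => ∃ r : ℝ, 0 < r ∧ ∀ E' ∈ f.support, E' ≠ E →
      v (f.coeff E') * r ^ E' < v (f.coeff E) * r ^ E).card

/-- number of EDGES of the Newton polygon (= number of distinct values of `v` on the roots of `f` in an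
algebraic closure, `v` non-archimedean, `f(0) ≠ 0`): the valuative twin of `#roots.toFinset`. [definition of the card] -/
def npEdges {F : Type} [Field F] (v : AbsoluteValue F ℝ) (f : Polynomial F) : ℕ := domCount v f - 1

/-- valuative census row of format `(m, K)`: over every non-archimedean valued field OF CHARACTERISTIC ZERO (rev 3, VERDICT #54 V2), every symmetric lacunary
pencil `Σ_l X^{d_l} S_l` of the format has at most `B` Newton-polygon edges. [candidate of the card] -/
def ValRootLawAt (m K B : ℕ) : Prop :=
  ∀ (F : Type) [Field F] [CharZero F] (v : AbsoluteValue F ℝ), IsNonarchimedean v →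
    ∀ (d : Fin K → ℕ) (S : Fin K → Matrix (Fin m) (Fin m) F), (∀ l, (S l).IsSymm) →
      npEdges v (Matrix.det (∑ l, ((Polynomial.X : Polynomial F) ^ d l) • (S l).map Polynomial.C)) ≤ B

/-- **vB** — the valuative `K + log² m` law (candidate, NOT asserted). -/
def ValKLaw : Prop := ∃ C : ℕ, ∀ m K : ℕ, ValRootLawAt m K (2 ^ (C * (K + Nat.log 2 m ^ 2)))

/-- **vMDR** — the valuative form of crux `MatrixDescartes` (stmt-18050) (candidate, NOT asserted). -/
def ValMatrixDescartes : Prop :=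
  ∀ c q : ℕ, 0 < q → ∃ K₀ : ℕ, ∀ K m : ℕ, K₀ ≤ K → m ≤ 2 ^ ((Nat.log 2 K + c) ^ c) →
    ∀ (F : Type) [Field F] [CharZero F] (v : AbsoluteValue F ℝ), IsNonarchimedean v →
      ∀ (d : Fin K → ℕ) (S : Fin K → Matrix (Fin m) (Fin m) F), (∀ l, (S l).IsSymm) →
        npEdges v (Matrix.det (∑ l, ((Polynomial.X : Polynomial F) ^ d l) • (S l).map Polynomial.C)) ^ q
          ≤ 2 ^ (K * Nat.log 2 K)

/-- **vW — VALUATIVE LIFTING** (the proposed transfer C⁺ of crux `WeakLifting`; candidate, NOT asserted): the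
tropical census row of format `(m, K)` (verbatim hypothesis of `WeakLifting`, = `TropRootLawAt m K n`) bounds the
Newton-polygon edge count of every symmetric lacunary pencil of that format over every non-archimedean field, with
slack `2^{C (K + ⌊log₂ m⌋²)}`.  FORMAT level on both sides (per pencil it is false: `K = 2` inflation). -/
def ValWeakLifting : Prop :=
  ∃ C : ℕ, ∀ m K n : ℕ, TropRootLawAt m K n → ValRootLawAt m K (2 ^ (C * (K + Nat.log 2 m ^ 2)) * (n + 1))

/-! ## Rev 3 additions (crit-6 g4 VERDICT #54, prices V3, V8, V9) -/

/-- **GENERAL (non-symmetric) valuative census row** — VERDICT #54 (a2)/V3: symmetry is void up to `m ↦ 2m`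
(`S_l := fromBlocks 0 M_l M_lᵀ 0` is symmetric with `det (Σ X^{d_l} S_l) = ± det (Σ X^{d_l} M_l)²`, same Newton
polygon up to doubling), so the honest object of the line is the determinant of a GENERAL lacunary `(m, K)` pencil
= a lacunary ABP of width `m` with `K` letters. [candidate] -/
def GenValRootLawAt (m K B : ℕ) : Prop :=
  ∀ (F : Type) [Field F] [CharZero F] (v : AbsoluteValue F ℝ), IsNonarchimedean v →
    ∀ (d : Fin K → ℕ) (M : Fin K → Matrix (Fin m) (Fin m) F),
      npEdges v (Matrix.det (∑ l, ((Polynomial.X : Polynomial F) ^ d l) • (M l).map Polynomial.C)) ≤ B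

/-- symmetric pencils are general pencils (the trivial direction). -/
theorem valRootLawAt_of_gen {m K B : ℕ} (h : GenValRootLawAt m K B) : ValRootLawAt m K B :=
  fun F _ _ v hv d S _ => h F v hv d S

/-- **SYMMETRY IS VOID** (VERDICT #54 (a2)) — OPEN support, routine (`Matrix.fromBlocks` + `det` of an anti-block-diagonal
matrix); recorded as a statement so the line's object can be quoted in ABP generality. [support, tag S] -/
def SymmetryVoid : Prop := ∀ m K B : ℕ, ValRootLawAt (2 * m) K B → GenValRootLawAt m K B

/-- **FIRST CONTENT RUNG (VERDICT #54 V8): the RANK-ONE SECTOR LAW**, uniform in `m` AND `K`, sign-blind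
(`ε_l` arbitrary scalars): letters `ε_l · u_l u_lᵀ`.  By Cauchy–Binet `det = Σ_{|I|=m} X^{E_I} (Π_{l∈I} ε_l) Δ_I(u)²`,
so the Newton points are `(E_I, 2·ord Δ_I + Σ ord ε_l)` with `ord ∘ Δ` a REALISABLE VALUATED MATROID (Dress–Wenzel):
`npEdges + 1` = number of bases that are unique optima of the parametric valuated-matroid problem
`min_I (π(I) + s·E_I)`, `s ∈ ℝ`.  Cancellation is PRESENT (the `m!`-fold signed Leibniz classes collapse to squares)
and INFLATION is LOCATED (npEdges > the pencil's own design count: (2,3) 2 > 1, (3,4) 3 > 2, (3,5) 4 > 2,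
`exp/rankone.py`), so the rung has content; the REAL signed rank-one sector (`Lines/Lift-rankone.md`: one negative
rank-one letter already gives `Z₊ = 6 > 2n`, p159188; `Z₊ ≤ poly(n, K)` OPEN) is its archimedean shadow.
[candidate rung; conjectured via matroid exchange; NOT asserted] -/
def ValRankOneLaw : Prop :=
  ∃ C : ℕ, ∀ (F : Type) [Field F] [CharZero F] (v : AbsoluteValue F ℝ), IsNonarchimedean v →
    ∀ (m K : ℕ) (d : Fin K → ℕ) (ε : Fin K → F) (u : Fin K → Fin m → F),
      npEdges v (Matrix.det (∑ l, ((Polynomial.X : Polynomial F) ^ d l) •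
        (ε l • Matrix.vecMulVec (u l) (u l)).map Polynomial.C)) ≤ (m * K) ^ C

/-- **sharp calibration form of the rank-one rung** (CONJECTURE from exact data in 7 cells, `exp/rankone.py`,
`exp/quartet.py`: max found = `m(K−m)` at (2,3),(2,4),(3,4), below it at (2,5),(2,6),(3,5),(3,6); `K = 4, m = 2`
proved by hand — the quartet lemma: the six points are never in strictly convex position for any tree metric).
Refutation welcome (calibration, not load-bearing). -/
def ValRankOneSharp : Prop :=
  ∀ (F : Type) [Field F] [CharZero F] (v : AbsoluteValue F ℝ), IsNonarchimedean v →
    ∀ (m K : ℕ) (d : Fin K → ℕ) (ε : Fin K → F) (u : Fin K → Fin m → F),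
      npEdges v (Matrix.det (∑ l, ((Polynomial.X : Polynomial F) ^ d l) •
        (ε l • Matrix.vecMulVec (u l) (u l)).map Polynomial.C)) ≤ m * (K - m)

/-! ### Skeleton rev 6 — the two statements above are LOCATED-FALSE as typed (repeated exponents): pen finding 2026-08-29T07:34:17Z
(Carstensen read-once bipartite embedding, `HOME/ideators/val-idea-24/g4/VALRANKONE-REFUTED-g4.md`), desk R3083 (1); kept byte-identical as
negative statements; Lean refutation = `Theorems/…` lane.  The true part is the injective-exponent law, next. -/

/-- **THE INJECTIVE-EXPONENT RANK-ONE LAW (skeleton rev 6; CALIBRATION, feeds nothing)** — `ValRankOneSharp` with exactly one inserted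
binder `Function.Injective d`: pairwise distinct exponents make the Cauchy–Binet classes exchange like matroid bases (a chain of uniquely
dominant `m`-subsets at increasing slopes has length `≤ m(K−m) + 1`), so `npEdges ≤ m(K−m)`, uniform in `m`, `K`, the field and the
absolute value.  = val-sym-lift-p1 g22 #7 `…KPlusLogSqLawValuativeDoorRankOneSharp.valRankOneSharpInj_unfolded` VERBATIM with `npEdges`
folded (crit-6 dock `CritDockV5.rankOneSharpInj_dock`, READ #190).  The repeated-exponent complement is located-false (block above). -/
def ValRankOneSharpInj : Prop :=
  ∀ (F : Type) [Field F] [CharZero F] (v : AbsoluteValue F ℝ), IsNonarchimedean v →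
    ∀ (m K : ℕ) (d : Fin K → ℕ) (ε : Fin K → F) (u : Fin K → Fin m → F), Function.Injective d →
      npEdges v (Matrix.det (∑ l, ((Polynomial.X : Polynomial F) ^ d l) •
        (ε l • Matrix.vecMulVec (u l) (u l)).map Polynomial.C)) ≤ m * (K - m)

/-- **LOCATED INFLATION IS HARMLESS UNDER COMMON CONGRUENCE** (lemma, provable: `det` is multiplicative and the root
radii of a product are the union): letters `A·diag(D_l)·Aᵀ` — the per-pencil design count can be `1` while
`npEdges = m` (the card's `K = 2` inflation `S₀ = A·diag(p^{h_i})·Aᵀ, S₁ = 1`), yet `det = det(A)²·Π_i (Σ_l D_l(i) X^{d_l})`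
has at most `m (K − 1)` root radii.  Shows that the per-pencil design is the wrong currency and the FORMAT census the
right one. [lemma, tag S] -/
def ValCongruenceLemma : Prop :=
  ∀ (F : Type) [Field F] [CharZero F] (v : AbsoluteValue F ℝ), IsNonarchimedean v →
    ∀ (m K : ℕ) (d : Fin K → ℕ) (A : Matrix (Fin m) (Fin m) F) (D : Fin K → Fin m → F),
      npEdges v (Matrix.det (∑ l, ((Polynomial.X : Polynomial F) ^ d l) •
        (A * Matrix.diagonal (D l) * A.transpose).map Polynomial.C)) ≤ m * (K - 1)

/-- **CALIBRATION v(2,4) = 8 < ζ(2,4) = 9** (VERDICT #54 (g), crit-6 g4's anti-Monge argument: the Gram matrix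
`[β(u_l, u_l')]` of four vectors in the 3-dimensional quadratic space `(a, c, b) ↦ ac − b²` is singular, while ten
points in strictly convex position would make the reversal the unique minimal Leibniz term): the first cell where the
valuative count is STRICTLY BELOW the real census — the ninth real root at (2,4) is an amoeba root.  A `Negative/`-style
calibration target (bounded `m`, not a rung). [calibration] -/
def ValTwoFourCalibration : Prop := ValRootLawAt 2 4 8

/-- **PencilTransfer at POLYNOMIAL level** (support; the tree's `pencilDet_of_affine` + `symmAffineRepr_of_isVPFamily_complex`
give it — `pencilTransfer_proof` records only the root finsets): if the complexification of a real family is `VP`,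
its restriction to a monomial curve IS the determinant of a real symmetric lacunary pencil of quasi-polynomial size. -/
def PencilTransferPoly : Prop :=
  ∀ (v : ℕ → ℕ) (f : ∀ n, MvPolynomial (Fin (v n)) ℝ),
    Literature.Computability.AlgebraicComplexity.IsVPFamily (fun n => MvPolynomial.map (algebraMap ℝ ℂ) (f n)) →
    ∀ d : (n : ℕ) → Fin (v n) → ℕ, ∃ c : ℕ, ∀ n : ℕ, ∃ m : ℕ, m ≤ 2 ^ ((Nat.log 2 n + c) ^ c) ∧
      ∃ S : Fin (v n + 1) → Matrix (Fin m) (Fin m) ℝ, (∀ l, (S l).IsSymm) ∧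
        Matrix.det (∑ l, ((Polynomial.X : Polynomial ℝ) ^ (Fin.cons (α := fun _ => ℕ) (0 : ℕ) (d n) l)) •
            (S l).map Polynomial.C) =
          MvPolynomial.aeval (fun i => (Polynomial.X : Polynomial ℝ) ^ d n i) (f n)

/-- **vΘ — the 2-adic Theta witness** (support): a real family with `VNP` complexification whose monomial restriction
has at least `2^{n⌊log₂ n⌋}` dominant exponents for EVERY non-archimedean absolute value with `|2| < 1`.  Candidate:
Tavenas' `P`-definable family with the constants `z_i ↦ 2^{-2^i}` (the tree's `thetaWitness_proof` uses `2^{2^i}`),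
restriction `Σ_{i<2^ν} 2^{-2i(2^ν-1-i)} X^i`, whose coefficient valuations are strictly CONVEX. -/
def ValThetaWitness : Prop :=
  ∃ (Θ : ∀ n : ℕ, MvPolynomial (Fin n) ℝ) (d : ∀ n : ℕ, Fin n → ℕ),
    Literature.Computability.AlgebraicComplexity.IsVNPFamily (fun n => MvPolynomial.map (algebraMap ℝ ℂ) (Θ n)) ∧
    ∃ n₀ : ℕ, ∀ n : ℕ, n₀ ≤ n → ∀ w : AbsoluteValue ℝ ℝ, IsNonarchimedean w → w 2 < 1 →
      2 ^ (n * Nat.log 2 n) ≤ npEdges w (MvPolynomial.aeval (fun i => (Polynomial.X : Polynomial ℝ) ^ d n i) (Θ n)) + 1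

/-- **(2-adic absolute value on ℝ)** (support; Chevalley extension / `ℂ ≃ ℂ₂` as abstract fields): some
non-archimedean absolute value on `ℝ` has `|2| < 1`. [folklore] -/
def TwoAdicOnReals : Prop := ∃ w : AbsoluteValue ℝ ℝ, IsNonarchimedean w ∧ w 2 < 1

/-- **CALIBRATION TARGET — the MODULAR sub-case of the sharp rank-one form** (crit-6 VERDICT #56 (γ), a two-line theorem on paper:
if all maximal minors of `u` are `v`-units then `π(I) = Σ_{l∈I} ord ε_l` is modular, each breakpoint along `s` swaps ONE letter for one
of strictly smaller exponent, so `Φ(I) = Σ_{l∈I} rank_d(l)` drops by `≥ 1` per breakpoint and ranges over an interval of length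
`m(K−m)`).  STATUS (crit-6 VERDICT #56b M1): PROVED ON PAPER FOR DISSOCIATED `d` (all `m`-subset sums distinct: class ↔ subset, NP
vertices = parametric optima, consecutive optima differ by one `Φ`-lowering swap) — that provable twin is `ValRankOneSharpModularDiss`
below, the line's first `Theorems/…` target; for GENERAL `d` in-class cancellation can raise or delete a class point and expose neighbours, so
this statement is a CONJECTURED calibration target (adversarial probes found no violation: crit-6 `chk/v56/modular_cancel_probe.py`,
`…probe2.py`, `…climb.py`).  [target for a `Theorems/…` file, not a stub] -/
def ValRankOneSharpModular : Prop :=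
  ∀ (F : Type) [Field F] [CharZero F] (v : AbsoluteValue F ℝ), IsNonarchimedean v →
    ∀ (m K : ℕ) (d : Fin K → ℕ) (ε : Fin K → F) (u : Fin K → Fin m → F),
      (∀ g : Fin m → Fin K, Function.Injective g → v (Matrix.det (Matrix.of fun i j => u (g j) i)) = 1) →
      npEdges v (Matrix.det (∑ l, ((Polynomial.X : Polynomial F) ^ d l) •
        (ε l • Matrix.vecMulVec (u l) (u l)).map Polynomial.C)) ≤ m * (K - m)

/-- **FIRST `Theorems/…` TARGET of the line — the modular sub-case on DISSOCIATED supports** (provable twin of `ValRankOneSharpModular`,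
crit-6 VERDICT #56 (γ) / #56b M1: unit maximal minors AND all `m`-subset exponent sums distinct ⇒ `npEdges ≤ m(K−m)` by the rank potential
`Φ(I) = Σ_{l∈I} rank_d(l)`).  [target, not a stub] -/
def ValRankOneSharpModularDiss : Prop :=
  ∀ (F : Type) [Field F] [CharZero F] (v : AbsoluteValue F ℝ), IsNonarchimedean v →
    ∀ (m K : ℕ) (d : Fin K → ℕ) (ε : Fin K → F) (u : Fin K → Fin m → F),
      Function.Injective (fun I : {s : Finset (Fin K) // s.card = m} => ∑ l ∈ I.1, d l) →
      (∀ g : Fin m → Fin K, Function.Injective g → v (Matrix.det (Matrix.of fun i j => u (g j) i)) = 1) →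
      npEdges v (Matrix.det (∑ l, ((Polynomial.X : Polynomial F) ^ d l) •
        (ε l • Matrix.vecMulVec (u l) (u l)).map Polynomial.C)) ≤ m * (K - m)

/-- the strictly-convex rung behind vΘ (support, checkable): over any field with a non-archimedean absolute value and
`0 < |2| < 1`, the polynomial `Σ_{i<N} 2^{i²} X^i` has all `N` exponents dominant. [folklore] -/
def ConvexRung : Prop :=
  ∀ (F : Type) [Field F] (v : AbsoluteValue F ℝ), IsNonarchimedean v → 0 < v 2 → v 2 < 1 →
    ∀ N : ℕ, domCount v (∑ i ∈ Finset.range N, Polynomial.C ((2 : F) ^ (i ^ 2)) * Polynomial.X ^ i) = N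

/-! ## The door (kernel glue, PROVED): vMDR ∧ PencilTransferPoly ∧ vΘ ∧ TwoAdicOnReals ⇒ VP_ℂ ≠ VNP_ℂ -/

/-- **The valuative door.**  Same arithmetic as the tree's `valiant_of_octaveMatrixDescartes`; the real zeros of the
restricted VNP family are never mentioned. -/
theorem valiant_of_valMatrixDescartes (hMDR : ValMatrixDescartes) (hT : PencilTransferPoly)
    (hW : ValThetaWitness) (hw : TwoAdicOnReals) : _root_.ValiantsHypothesis := by
  show Literature.Computability.AlgebraicComplexity.VP ℂ ≠ Literature.Computability.AlgebraicComplexity.VNP ℂ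
  intro hEq
  obtain ⟨w, hwna, hw2⟩ := hw
  obtain ⟨Θ, d, hVNP, n₀, hdom⟩ := hW
  have hVP : Literature.Computability.AlgebraicComplexity.IsVPFamily
      (fun n => MvPolynomial.map (algebraMap ℝ ℂ) (Θ n)) := by
    have hmem := (Literature.Computability.AlgebraicComplexity.mem_VNP_ofFintype_iff_holds _).2 hVNP
    rw [← hEq] at hmem
    exact (Literature.Computability.AlgebraicComplexity.mem_VP_ofFintype_iff_holds _).1 hmem
  obtain ⟨c, hc⟩ := hT (fun n => n) Θ hVP d
  obtain ⟨K₀, hK⟩ := hMDR c 4 (by norm_num)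
  obtain ⟨n, hn₀, hnK, hn4⟩ : ∃ n, n₀ ≤ n ∧ K₀ ≤ n ∧ 4 ≤ n := ⟨n₀ + K₀ + 4, by omega, by omega, by omega⟩
  obtain ⟨m, hm, S, hS, hdet⟩ := hc n
  set Z := npEdges w (MvPolynomial.aeval (fun i => (Polynomial.X : Polynomial ℝ) ^ d n i) (Θ n)) with hZ
  have hm' : m ≤ 2 ^ ((Nat.log 2 (n + 1) + c) ^ c) :=
    hm.trans (Nat.pow_le_pow_right (by norm_num)
      (Nat.pow_le_pow_left (Nat.add_le_add_right (Nat.log_mono_right (Nat.le_succ n)) c) c))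
  have h1 := hK (n + 1) m (by omega) hm' ℝ w hwna (Fin.cons (α := fun _ => ℕ) (0 : ℕ) (d n)) S hS
  rw [hdet] at h1
  have h2 : 2 ^ (n * Nat.log 2 n) ≤ Z + 1 := hdom n hn₀ w hwna hw2
  set L := Nat.log 2 n with hL
  have hL2 : 2 ≤ L := by
    rw [hL]
    calc 2 = Nat.log 2 4 := by decide
      _ ≤ Nat.log 2 n := Nat.log_mono_right hn4
  have hLn : L ≤ n := by rw [hL]; exact Nat.log_le_self 2 n
  have hL' : Nat.log 2 (n + 1) ≤ L + 1 := by
    rw [hL]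
    calc Nat.log 2 (n + 1) ≤ Nat.log 2 (n * 2) := Nat.log_mono_right (by omega)
      _ = Nat.log 2 n + 1 := Nat.log_mul_base (by norm_num) (by omega)
  have h3 : Z ^ 4 ≤ 2 ^ ((n + 1) * (L + 1)) :=
    h1.trans (Nat.pow_le_pow_right (by norm_num) (Nat.mul_le_mul_left _ hL'))
  have hnL : 1 ≤ n * L := by nlinarith
  have h4 : 2 ^ (n * L - 1) ≤ Z := by
    have e : 2 ^ (n * L) = 2 * 2 ^ (n * L - 1) := by
      rw [← Nat.pow_succ']
      congr 1
      omega
    have h2' := h2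
    rw [e] at h2'
    have : 1 ≤ 2 ^ (n * L - 1) := Nat.one_le_two_pow
    omega
  have h5 : 2 ^ (4 * (n * L - 1)) ≤ Z ^ 4 := by
    rw [pow_mul']
    exact Nat.pow_le_pow_left h4 4
  have h6 : 4 * (n * L - 1) ≤ (n + 1) * (L + 1) :=
    (Nat.pow_le_pow_iff_right (by norm_num)).1 (h5.trans h3)
  have h7 : 6 * n ≤ 3 * (n * L) := by nlinarith
  have h6' : 4 * (n * L - 1) ≤ n * L + n + L + 1 := by
    have e : (n + 1) * (L + 1) = n * L + n + L + 1 := by ring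
    rw [e] at h6
    exact h6
  generalize hP : n * L = P at h6' h7 hnL
  omega

/-- monotonicity of the valuative row in the bound. [folklore] -/
theorem valRootLawAt_mono {m K B B' : ℕ} (h : B ≤ B') (hB : ValRootLawAt m K B) : ValRootLawAt m K B' :=
  fun F _ _ v hv d S hS => (hB F v hv d S hS).trans h

/-- a constant has no Newton edge. [folklore] -/
theorem npEdges_C {F : Type} [Field F] (v : AbsoluteValue F ℝ) (a : F) : npEdges v (Polynomial.C a) = 0 := by
  unfold npEdges domCount
  have h1 : ((Polynomial.C a).support.filter fun E => ∃ r : ℝ, 0 < r ∧ ∀ E' ∈ (Polynomial.C a).support, E' ≠ E →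
      v ((Polynomial.C a).coeff E') * r ^ E' < v ((Polynomial.C a).coeff E) * r ^ E).card ≤ 1 :=
    (Finset.card_le_card ((Finset.filter_subset _ _).trans (Polynomial.support_C_subset a))).trans (by simp)
  omega

/-- with no letters the valuative row is trivial (the pencil is the zero / empty matrix). [folklore] -/
theorem valRootLawAt_zero_letters (m B : ℕ) : ValRootLawAt m 0 B := by
  intro F _ _ v hv d S hS
  have h0 : (∑ l, ((Polynomial.X : Polynomial F) ^ d l) • (S l).map Polynomial.C) = 0 := by
    simp
  rw [h0]
  rcases Nat.eq_zero_or_pos m with hm | hm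
  · subst hm
    rw [Matrix.det_isEmpty, ← Polynomial.C_1, npEdges_C]; exact Nat.zero_le _
  · haveI : Nonempty (Fin m) := ⟨⟨0, hm⟩⟩
    rw [Matrix.det_zero, ← Polynomial.C_0, npEdges_C]; exact Nat.zero_le _

/-- **relative door, law form**: `TropicalB ∧ vW ⇒ vB` — the tree's `TropicalB` is stated for designs `(d, v, ε)`, which is
exactly `TropRootLawAt`; so the valuative K-law follows from TB and valuative lifting with `C ↦ C_W + C_T + 1`. -/
theorem valKLaw_of_tropicalB (hT : TropicalB) (hW : ValWeakLifting) : ValKLaw := by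
  obtain ⟨CT, hCT⟩ := hT
  obtain ⟨CW, hCW⟩ := hW
  refine ⟨CW + CT + 1, fun m K => ?_⟩
  have hrow : TropRootLawAt m K (2 ^ (CT * (K + Nat.log 2 m ^ 2))) :=
    fun d v ε n θ p hε hθ hdom halt => hCT m K d v ε n θ p hε hθ hdom halt
  have h1 := hCW m K _ hrow
  rcases Nat.eq_zero_or_pos K with hK0 | hKpos
  · subst hK0; exact valRootLawAt_zero_letters m _
  refine valRootLawAt_mono ?_ h1
  have hK : 0 < K + Nat.log 2 m ^ 2 := by omega
  have e1 : 2 ^ (CT * (K + Nat.log 2 m ^ 2)) + 1 ≤ 2 ^ (CT * (K + Nat.log 2 m ^ 2) + 1) :=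
    Nat.pow_lt_pow_right (by norm_num) (Nat.lt_succ_self _)
  calc 2 ^ (CW * (K + Nat.log 2 m ^ 2)) * (2 ^ (CT * (K + Nat.log 2 m ^ 2)) + 1)
      ≤ 2 ^ (CW * (K + Nat.log 2 m ^ 2)) * 2 ^ (CT * (K + Nat.log 2 m ^ 2) + 1) := Nat.mul_le_mul_left _ e1
    _ = 2 ^ (CW * (K + Nat.log 2 m ^ 2) + (CT * (K + Nat.log 2 m ^ 2) + 1)) := (pow_add _ _ _).symm
    _ ≤ 2 ^ ((CW + CT + 1) * (K + Nat.log 2 m ^ 2)) :=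
      Nat.pow_le_pow_right (by norm_num) (by nlinarith [hK, Nat.zero_le (Nat.log 2 m ^ 2)])


/-! ## Sign-free variant (addendum, g3): the UNSIGNED combinatorial census as hypothesis

The valuative side never sees signs, so the natural lifting hypothesis is Murota's combinatorial Newton
diagram of the design: the number of breakpoints of the `K`-slope-class parametric assignment value function,
i.e. chains of unique optima with consecutive optima DISTINCT (no sign alternation asked).  `CombRootLawAt m K n`
implies the signed row `TropRootLawAt m K n` (alternating signs force consecutive optima to differ), so
`CombB → TropicalB`; and `CombB ∧ ValLiftingU ⇒ vB ⇒ vMDR ⇒ Valiant` with the same glue.  All candidates, none asserted. -/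

/-- **Combinatorial (unsigned) census row**: every chain of `n' + 1` unique optima of an `(m, K)` design at strictly
increasing integer slopes with consecutive optima distinct has `n' ≤ n` (= the design's parametric-assignment value
function has at most `n` breakpoints). [definition of the card; Murota 1990 Prop 2.2 dictionary] -/
def CombRootLawAt (m K n : ℕ) : Prop :=
  ∀ (d : Fin K → ℕ) (v ε : Fin m → Fin m → Fin K → ℤ) (n' : ℕ) (θ : Fin (n' + 1) → ℤ)
    (p : Fin (n' + 1) → Equiv.Perm (Fin m) × (Fin m → Fin K)),
    (∀ i j l, (ε i j l).natAbs ≤ 1) → StrictMono θ →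
    (∀ k, Summit.ValiantsHypothesis.ValiantsHypothesis.Theorems.MatrixDescartes.Negative.IsDominant d v ε (θ k) (p k)) →
    (∀ k : Fin n', p k.castSucc ≠ p k.succ) → n' ≤ n

/-- **CombB** — the unsigned tropical `K + log² m` law (candidate, NOT asserted): the combinatorial Newton diagram of an
`(m, K)` design has at most `2^{C (K + ⌊log₂ m⌋²)}` breakpoints.  A statement about parametric ASSIGNMENT problems with
`K` slope classes only (Carstensen / Mulmuley–Shah staircases sit at `2^{Θ(log² m)}`, inside). -/
def CombB : Prop := ∃ C : ℕ, ∀ m K : ℕ, CombRootLawAt m K (2 ^ (C * (K + Nat.log 2 m ^ 2)))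

/-- **vU — sign-free valuative lifting** (candidate, NOT asserted): the true Newton polygon of a symmetric lacunary
pencil over a non-archimedean field has at most `2^{C (K + ⌊log₂ m⌋²)} · (n + 1)` edges whenever every `(m, K)` design has
at most `n` combinatorial breakpoints.  Weaker hypothesis-side than `ValWeakLifting` (it assumes the larger unsigned
census), hence `ValWeakLifting → ValLiftingU`. -/
def ValLiftingU : Prop :=
  ∃ C : ℕ, ∀ m K n : ℕ, CombRootLawAt m K n → ValRootLawAt m K (2 ^ (C * (K + Nat.log 2 m ^ 2)) * (n + 1))

/-- the unsigned row implies the signed row: sign alternation forces consecutive optima to be distinct. [folklore] -/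
theorem tropRootLawAt_of_combRootLawAt {m K n : ℕ} (h : CombRootLawAt m K n) : TropRootLawAt m K n := by
  intro d v ε n' θ p hε hθ hdom halt
  refine h d v ε n' θ p hε hθ hdom fun k heq => ?_
  have hk := halt k
  rw [heq] at hk
  exact absurd hk (not_lt.mpr (mul_self_nonneg _))

/-- `CombB → TropicalB`. [folklore] -/
theorem tropicalB_of_combB (h : CombB) : TropicalB := by
  obtain ⟨C, hC⟩ := h
  exact ⟨C, fun m K d v ε n θ p hε hθ hdom halt =>
    tropRootLawAt_of_combRootLawAt (hC m K) d v ε n θ p hε hθ hdom halt⟩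

/-- `ValWeakLifting → ValLiftingU` (the sign-free lifting statement is the weaker one). [folklore] -/
theorem valLiftingU_of_valWeakLifting (h : ValWeakLifting) : ValLiftingU := by
  obtain ⟨C, hC⟩ := h
  exact ⟨C, fun m K n hrow => hC m K n (tropRootLawAt_of_combRootLawAt hrow)⟩

/-- **sign-free relative door, law form**: `CombB ∧ vU ⇒ vB`. -/
theorem valKLaw_of_combB (hB : CombB) (hU : ValLiftingU) : ValKLaw := by
  obtain ⟨CT, hCT⟩ := hB
  obtain ⟨CW, hCW⟩ := hU
  refine ⟨CW + CT + 1, fun m K => ?_⟩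
  have h1 := hCW m K _ (hCT m K)
  rcases Nat.eq_zero_or_pos K with hK0 | hKpos
  · subst hK0; exact valRootLawAt_zero_letters m _
  refine valRootLawAt_mono ?_ h1
  have hK : 0 < K + Nat.log 2 m ^ 2 := by omega
  have e1 : 2 ^ (CT * (K + Nat.log 2 m ^ 2)) + 1 ≤ 2 ^ (CT * (K + Nat.log 2 m ^ 2) + 1) :=
    Nat.pow_lt_pow_right (by norm_num) (Nat.lt_succ_self _)
  calc 2 ^ (CW * (K + Nat.log 2 m ^ 2)) * (2 ^ (CT * (K + Nat.log 2 m ^ 2)) + 1)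
      ≤ 2 ^ (CW * (K + Nat.log 2 m ^ 2)) * 2 ^ (CT * (K + Nat.log 2 m ^ 2) + 1) := Nat.mul_le_mul_left _ e1
    _ = 2 ^ (CW * (K + Nat.log 2 m ^ 2) + (CT * (K + Nat.log 2 m ^ 2) + 1)) := (pow_add _ _ _).symm
    _ ≤ 2 ^ ((CW + CT + 1) * (K + Nat.log 2 m ^ 2)) :=
      Nat.pow_le_pow_right (by norm_num) (by nlinarith [hK, Nat.zero_le (Nat.log 2 m ^ 2)])

/-- **vB ⇒ vMDR** (the arithmetic of `octaveMatrixDescartes_of_octaveKLaw`, valuative form). [folklore] -/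
theorem valMatrixDescartes_of_valKLaw (h : ValKLaw) : ValMatrixDescartes := by
  obtain ⟨C, hC⟩ := h
  intro c q _hq
  obtain ⟨K₁, hK₁⟩ := Summit.ValiantsHypothesis.ValiantsHypothesis.Theorems.LacunarySymmetroidMatrixDescartes.StubArith4.exp_le
    (2 * c) (2 * q * C)
  refine ⟨max K₁ (2 ^ (2 * q * C)), fun K m hK hm F _ _ v hv d S hS => ?_⟩
  have hK1 : K₁ ≤ K := le_of_max_le_left hK
  have hK2 : 2 ^ (2 * q * C) ≤ K := le_of_max_le_right hK
  have hL : 2 * q * C ≤ Nat.log 2 K := by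
    have := Nat.log_mono_right (b := 2) hK2
    rwa [Nat.log_pow one_lt_two] at this
  have hlogm : Nat.log 2 m ≤ (Nat.log 2 K + c) ^ c :=
    calc Nat.log 2 m ≤ Nat.log 2 (2 ^ ((Nat.log 2 K + c) ^ c)) := Nat.log_mono_right hm
      _ = (Nat.log 2 K + c) ^ c := Nat.log_pow one_lt_two _
  have hsq : Nat.log 2 m ^ 2 ≤ (Nat.log 2 K + 2 * c) ^ (2 * c) :=
    calc Nat.log 2 m ^ 2 ≤ ((Nat.log 2 K + c) ^ c) ^ 2 := Nat.pow_le_pow_left hlogm 2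
      _ = (Nat.log 2 K + c) ^ (2 * c) := by rw [← pow_mul, mul_comm]
      _ ≤ (Nat.log 2 K + 2 * c) ^ (2 * c) := Nat.pow_le_pow_left (by omega) _
  have hZ := hC m K F v hv d S hS
  have h1 : 2 * q * C * (Nat.log 2 K + 2 * c) ^ (2 * c) ≤ K * Nat.log 2 K := hK₁ K hK1
  have h2 : 2 * q * C * K ≤ K * Nat.log 2 K :=
    calc 2 * q * C * K = K * (2 * q * C) := by ring
      _ ≤ K * Nat.log 2 K := Nat.mul_le_mul_left K hL
  have hexp : q * (C * (K + Nat.log 2 m ^ 2)) ≤ K * Nat.log 2 K := by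
    have h3 : q * C * Nat.log 2 m ^ 2 ≤ q * C * (Nat.log 2 K + 2 * c) ^ (2 * c) := Nat.mul_le_mul_left _ hsq
    have e1 : q * (C * (K + Nat.log 2 m ^ 2)) = q * C * K + q * C * Nat.log 2 m ^ 2 := by ring
    have e2 : 2 * q * C * (Nat.log 2 K + 2 * c) ^ (2 * c) = 2 * (q * C * (Nat.log 2 K + 2 * c) ^ (2 * c)) := by ring
    have e3 : 2 * q * C * K = 2 * (q * C * K) := by ring
    rw [e2] at h1
    rw [e3] at h2
    omega
  calc npEdges v (Matrix.det (∑ l, ((Polynomial.X : Polynomial F) ^ d l) • (S l).map Polynomial.C)) ^ q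
      ≤ (2 ^ (C * (K + Nat.log 2 m ^ 2))) ^ q := Nat.pow_le_pow_left hZ q
    _ = 2 ^ (q * (C * (K + Nat.log 2 m ^ 2))) := by rw [← pow_mul, mul_comm]
    _ ≤ 2 ^ (K * Nat.log 2 K) := Nat.pow_le_pow_right (by norm_num) hexp

/-- **The relative valuative door** (kernel): `TropicalB → ValWeakLifting → (supports) → VP_ℂ ≠ VNP_ℂ`.  The real
`WeakLifting` (stmt-19561) is NOT used: valuative lifting REPLACES it on the path to the summit. -/
theorem valiant_of_valWeakLifting (hTB : TropicalB) (hW : ValWeakLifting) (hT : PencilTransferPoly)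
    (hΘ : ValThetaWitness) (hw : TwoAdicOnReals) : _root_.ValiantsHypothesis :=
  valiant_of_valMatrixDescartes (valMatrixDescartes_of_valKLaw (valKLaw_of_tropicalB hTB hW)) hT hΘ hw


/-- **The sign-free valuative door**: `CombB ∧ ValLiftingU ∧ PencilTransferPoly ∧ ValThetaWitness ∧ TwoAdicOnReals ⇒ VP_ℂ ≠ VNP_ℂ`
— no sign, no real zero and no archimedean quantity occurs in any hypothesis. -/
theorem valiant_of_valLiftingU (hB : CombB) (hU : ValLiftingU) (hT : PencilTransferPoly)
    (hΘ : ValThetaWitness) (hw : TwoAdicOnReals) : _root_.ValiantsHypothesis :=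
  valiant_of_valMatrixDescartes (valMatrixDescartes_of_valKLaw (valKLaw_of_combB hB hU)) hT hΘ hw

/-! ## JOINT THEOREMS (price L1): exactly the door, no further hypothesis -/

/-- **L1 — the route's `closes` re-certified through the valuative door (signed census).** -/
theorem weakLifting_route_closes_val :
    TropicalB → ValWeakLifting → PencilTransferPoly → ValThetaWitness → TwoAdicOnReals → _root_.ValiantsHypothesis :=
  fun hTB hW hT hΘ hw => valiant_of_valWeakLifting hTB hW hT hΘ hw

/-- **L1 — sign-free variant: unsigned census `CombB` and the weaker lifting vU.** -/
theorem weakLifting_route_closes_valU :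
    CombB → ValLiftingU → PencilTransferPoly → ValThetaWitness → TwoAdicOnReals → _root_.ValiantsHypothesis :=
  fun hB hU hT hΘ hw => valiant_of_valLiftingU hB hU hT hΘ hw

/-! ## REGISTERED STUBS (price L2) and the composition through them -/

/-- **stub [δ, S — support]** — PencilTransfer at polynomial level: δ of `pencilDet_of_affine` +
`symmAffineRepr_of_isVPFamily_complex` («descend, don't realify»: the tree gives a REAL matrix `B` with `IsAffineDetRepr (f n) B`).
Implied by nothing recorded as a theorem yet; expected routine. -/
theorem stub_pencilTransferPoly : PencilTransferPoly := by
  -- CLOSED (skeleton rev 3): lift-p1 g21 p701081 `…ValuativeDoorPencilTransferPoly` (the tree's descent chain minus the forgetful step).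
  exact Summit.ValiantsHypothesis.ValiantsHypothesis.Theorems.KPlusLogSqLaw.ValDoor.pencilTransferPoly_unfolded

/-- **stub [M]+[S — support]** — (i) VNP-membership of the reciprocal-constant theta family `Θ⁺_n` (coefficients `4^{B^{i+j}}·[bits]`,
Valiant's criterion; template `thetaWitness_proof` / `isVNPFamily_aeval_of_isPBounded`) [M]; (ii) the strictly convex 2-adic profile
`ord = 2k²` ⇒ `2^{n⌊log₂n⌋}` dominant exponents (`ConvexRung`-type count) [S].  Implied by nothing known in the tree; expected routine. -/
theorem stub_valThetaWitness : ValThetaWitness := by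
  -- CLOSED (skeleton rev 5): lift-p1 g22 p704458 `…ValuativeDoorThetaWitness` — differs from plan-theta: PARAMETRIC Kronecker identity `aeval_kpc_hV`
  -- on the tree's `hV` (after `TowerDoor.map_hV`) + RECIPROCAL digit constants `(1/2)^{2^l}` (strictly log-concave 2-adic profile ⇒ all `2^ν`
  -- exponents dominant, `card_dominant_thetaRestriction`) instead of a `ConvexRung` call on Tavenas' own constants (log-convex ⇒ only 2 dominant).
  exact Summit.ValiantsHypothesis.ValiantsHypothesis.Theorems.KPlusLogSqLaw.ValDoor.valThetaWitness_unfolded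

/-- **stub [M — support; formalisation debt, folklore]** — a non-archimedean absolute value on `ℝ` with `|2| < 1`: Chevalley extension of
`|·|₂` along `ℚ ⊂ ℝ` (or `ℂ ≅ ℂ₂` by `IsAlgClosed.ringEquivOfCardinalEqOfCharZero` + spectral norm).  NOT in Mathlib as stated.  (Cheaper
equivalent if the laws keep `∀ F`: an absolute value on the finitely generated field `ℚ(entries)` suffices.) -/
theorem stub_twoAdicOnReals : TwoAdicOnReals := by
  -- CLOSED (skeleton rev 3): lift-p1 g21 p701887 `…ValuativeDoorTwoAdicOnReals` (Steinitz transport ℂ ≃+* ℚ̄₂ = `PadicAlgCl 2`, spectral norm).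
  exact Summit.ValiantsHypothesis.ValiantsHypothesis.Theorems.KPlusLogSqLaw.ValDoor.twoAdicOnReals_unfolded

/-- **stub [S — support] SYMMETRY IS VOID up to `m ↦ 2m`** (crit-6 VERDICT #54 (a2)): `fromBlocks 0 M Mᵀ 0` is symmetric and its pencil
determinant is `± (det of the general pencil)²` — same Newton polygon doubled.  Lets the line quote its object as general lacunary pencils /
lacunary ABPs of width `m`.  Expected routine. -/
theorem stub_symmetryVoid : SymmetryVoid := by
  -- CLOSED (skeleton rev 3): lift-p1 g21 p700868 `…ValuativeDoorSymmetryVoid` (+ p700032 `…Squaring`, the ultrametric half).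
  exact Summit.ValiantsHypothesis.ValiantsHypothesis.Theorems.KPlusLogSqLaw.ValDoor.symmetryVoid_unfolded

/-- **stub [CALIBRATION — skeleton rev 6; was `stub_valRankOneLaw : ValRankOneLaw` (revs 2–5), RE-TYPED by desk R3083 (3)(i)]** the
INJECTIVE-EXPONENT rank-one law `npEdges ≤ m(K−m)`.  Why re-typed: `ValRankOneLaw` as typed (repeats allowed) is located-false on paper (header
«Skeleton rev 6»; crit-6 VERDICT #63 had already shown it summit-strength on the V5 bytes: `ValRankOneLaw → ValMatrixDescartes →` (three kernel
door stubs) `→ ValiantsHypothesis`, i.e. mis-typed for a rung).  This stub FEEDS NOTHING (no theorem of the skeleton consumes it); it closes by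
`exact Summit.ValiantsHypothesis.ValiantsHypothesis.Theorems.KPlusLogSqLaw.ValDoor.valRankOneSharpInj_unfolded` the moment lift-p1 g22 #7
`Theorems/KPlusLogSqLawValuativeDoorRankOneSharp.lean` is ACCEPTED (re-pin class wire, skeleton rev 7) — until then it is the skeleton's one
`sorry`.  LOCATED DATA behind the sharp constant (kit-free, inherited from the rev-5 docstring): planner `HOME/ideators/val-idea-24/g3/exp/rankone.py`
and critic `chk/v56/rankone_probe.py` (62732759c1796b5d): `m(K−m)` attained exactly at (2,4) 4 · (2,5) 6 · (2,6) 8 · (2,7) 10 · (2,8) 12 · (3,4) 3 ·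
(3,5) 6 · (3,6) 9 on towers `d_l = 2^l` (injective), zero exceedances; dissociated case kernel (p700449 modular, lift-p1 #5 p-pending
`valRankOneSharpDiss_unfolded`).  After this stub closes the skeleton has NO content stub: LINE (V)'s mathematics lives entirely in the OPEN
hypotheses `TropicalB ∧ ValWeakLifting` (resp. `CombB ∧ ValLiftingU`) of the sorry-free head. -/
theorem stub_valRankOneSharpInj : ValRankOneSharpInj := by
  -- CLOSED (skeleton rev 7): lift-p1 g22 #7 p706528 `…ValuativeDoorRankOneSharp` (matroid exchange on injective exponents; sharp `m(K−m)`).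
  exact Summit.ValiantsHypothesis.ValiantsHypothesis.Theorems.KPlusLogSqLaw.ValDoor.valRankOneSharpInj_unfolded

/-- **COMPOSITION through the stubs (kernel modulo the remaining `sorry`s above; vW and the route's census item are hypotheses).** -/
theorem valiant_of_stubs (hTB : TropicalB) (hW : ValWeakLifting) : _root_.ValiantsHypothesis :=
  weakLifting_route_closes_val hTB hW stub_pencilTransferPoly stub_valThetaWitness stub_twoAdicOnReals

/-- **THE LINE'S REGISTERED TARGET (rev 2; registration shape = tower_graft's `TowerWeakLifting`/`towerWeakLifting_skeleton`,
`ledger skeleton check … --crux-decl …ValDoor.ValDoorCloses`)**: the valuative door itself — from the route's census item and the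
transferred crux vW to the summit.  What the line PROVES modulo its three door stubs; vW stays a hypothesis (it is the line's form of the
crux, incomparable with `WeakLifting`, and is NOT claimed). -/
def ValDoorCloses : Prop := TropicalB → ValWeakLifting → _root_.ValiantsHypothesis

/-! ## Skeleton rev 3 — CALIBRATION WIRES (kernel, by name; re-pin class: `theorem … := <landed name>`, no new `def`, no stub statement moved)

The line's first `Theorems/…` targets are KERNEL (lift-p1 g21, 2026-08-29): `ValRankOneSharpModularDiss` (p700449, on p698921 + p699949),
the support def `ConvexRung` (p699982) and (skeleton rev 4) the card lemma `ValCongruenceLemma` (p702744).  VP ≠ VNP is NOT proved; these are calibration statements and close nothing on the ledger. -/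

/-- **KERNEL (p700449 `…ValuativeDoorRankOneDomCount.valRankOneSharpModularDiss_unfolded`)** — the dissociated modular rank-one
bound `npEdges ≤ m (K − m)`, uniform in `m` and `K`, every field, every absolute value (the NA / char-0 binders are unused here). -/
theorem valRankOneSharpModularDiss_holds : ValRankOneSharpModularDiss :=
  Summit.ValiantsHypothesis.ValiantsHypothesis.Theorems.KPlusLogSqLaw.ValDoor.valRankOneSharpModularDiss_unfolded

/-- **KERNEL (p699982 `…ValuativeDoorConvexRung.convexRung_unfolded`)** — the strictly convex rung: `N` dominant exponents. -/
theorem convexRung_holds : ConvexRung :=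
  Summit.ValiantsHypothesis.ValiantsHypothesis.Theorems.KPlusLogSqLaw.ValDoor.convexRung_unfolded

/-- **KERNEL (p702744 `…ValuativeDoorCongruence.valCongruenceLemma_unfolded`; skeleton rev 4)** — the congruence-class lemma
`npEdges (det Σ_l X^{d_l} A·diag(D_l)·Aᵀ) ≤ m (K − 1)` (product of `m` lacunary `K`-nomials; ultrametric Newton polygon of a product). -/
theorem valCongruenceLemma_holds : ValCongruenceLemma :=
  Summit.ValiantsHypothesis.ValiantsHypothesis.Theorems.KPlusLogSqLaw.ValDoor.valCongruenceLemma_unfolded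

/-- **SKELETON THEOREM (skeleton rev 2; skeleton rev 3: three of the five stubs are kernel-closed wires; skeleton rev 5: four of five — only `stub_valRankOneLaw` carries a `sorry`; skeleton rev 6: that stub RE-TYPED to the calibration statement `stub_valRankOneSharpInj`, the one `sorry`, consumed by nothing)** — `ValDoorCloses` BY NAME through the stubs only. -/
theorem valDoorCloses_skeleton : ValDoorCloses := fun hTB hW => valiant_of_stubs hTB hW

/-- the general-pencil form of any valuative row, through `stub_symmetryVoid` (how the stub is consumed). -/
theorem genValRootLawAt_of_stub {m K B : ℕ} (h : ValRootLawAt (2 * m) K B) : GenValRootLawAt m K B :=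
  stub_symmetryVoid m K B h

/-- **the crux BY NAME (record only)**: `WeakLifting` follows from Conjecture B outright (tree `weakLifting_of_kPlusLogSqLaw`); the line's
own statements neither imply nor follow from `WeakLifting`. -/
theorem WeakLifting_of_kPlusLogSqLaw'
    (hB : Summit.ValiantsHypothesis.ValiantsHypothesis.Theorems.LacunarySymmetroidMatrixDescartes.KPlusLogSqLaw) :
    Summit.ValiantsHypothesis.ValiantsHypothesis.Theses.KPlusLogSqLaw.WeakLifting := by
  obtain ⟨C, hC⟩ :=
    Summit.ValiantsHypothesis.ValiantsHypothesis.Theorems.LacunarySymmetroidMatrixDescartes.TropicalCensus.weakLifting_of_kPlusLogSqLaw hB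
  exact ⟨C, fun m K n hT => hC m K n hT⟩

/-! ### Skeleton rev 7 — RECORD WIRES (re-pin class; no def byte, no stub-signature byte; desk R3102 (A), crit-6 g6 READ #198 (e))

`ValRankOneLaw → ValMatrixDescartes` is lift-p1 g22 #8′ (✓ p706809) BY NAME — its antecedent is REFUTED (below / header «Skeleton rev 6»), so this
direction is recorded as VACUOUS knowledge for the ledger only («repeats = universality»: it is the reason the law as typed was summit-strength).
NO `valiant_of_valRankOneLaw` is wired (crit-6 VERDICT #64 (3)(e): a kernel term `False-on-paper → VH` is noise). -/

/-- **KERNEL, VACUOUS DIRECTION (✓ p706809 `…ValuativeDoorRankOneLawToMDR.valMatrixDescartes_of_valRankOneLaw_unfolded`)** — repeats =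
universality: a polynomial rank-one valuative law with ARBITRARY exponents would give valuative Matrix-Descartes.  The antecedent
`ValRankOneLaw` is refuted (skeleton rev 6 record); recorded, consumed by nothing. -/
theorem valMatrixDescartes_of_valRankOneLaw (h : ValRankOneLaw) : ValMatrixDescartes :=
  Summit.ValiantsHypothesis.ValiantsHypothesis.Theorems.KPlusLogSqLaw.ValDoor.valMatrixDescartes_of_valRankOneLaw_unfolded h

/-- **KERNEL NEGATIVE (skeleton rev 8; ✓ p707869 lift-p1 g22 #13 `…ValuativeDoorRankOneLawFalse.not_valRankOneLaw_unfolded`; desk R3112 (A))** —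
`ValRankOneLaw` AS TYPED is FALSE: class refuted-MISSTATED (the witness = the Carstensen / Gajjar–Radhakrishnan parametric-shortest-path DAG
pencil with NATURAL weights — `exists_paramDAG_strictLeads_nat` + `det_hessNeg_labels` + `le_card_dominant_pathPoly` — exploits REPEATED letter
exponents, i.e. the universality `valMatrixDescartes_of_valRankOneLaw` above; pen finding 2026-08-29 07:34Z, crit-6 VERDICT #64, desk R3083 (1) /
R3102 (A)).  Minimal repaired statement C′ = `ValRankOneSharpInj` (injective `d`) is a THEOREM (`stub_valRankOneSharpInj`, ✓ p706528).  The frozen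
docstrings of `ValRankOneLaw` / `ValRankOneSharp` above read historically; this wire is the record.  Consumed by nothing. -/
theorem not_valRankOneLaw : ¬ ValRankOneLaw :=
  Summit.ValiantsHypothesis.ValiantsHypothesis.Theorems.KPlusLogSqLaw.ValDoor.not_valRankOneLaw_unfolded

/-- **KERNEL NEGATIVE (skeleton rev 8; ✓ p707869 `…not_valRankOneSharp_unfolded`)** — the sharp form `npEdges ≤ m(K−m)` with ARBITRARY
exponents is FALSE as well (same witness; the budget is polynomial).  Consumed by nothing. -/
theorem not_valRankOneSharp : ¬ ValRankOneSharp :=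
  Summit.ValiantsHypothesis.ValiantsHypothesis.Theorems.KPlusLogSqLaw.ValDoor.not_valRankOneSharp_unfolded

/-! ### Skeleton rev 9 — CALIBRATION WIRES (re-pin class; no def byte, no stub-signature byte; desk R3119 (A) / R3126 (A))

Kernel rows of the valuative census BY NAME.  Calibration only: consumed by nothing, credit nothing toward 19561 / 18050 / 5069. -/

/-- **KERNEL CALIBRATION (✓ p711670 lift-p1 g22 #16 `…ValuativeDoorTwoFourCalibration.valTwoFourCalibration_unfolded`)** — the card's
(m, K) = (2, 4) calibration target `ValTwoFourCalibration` (= `ValRootLawAt 2 4 8`: npEdges ≤ 8 for every symmetric 2×2 pencil with four letters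
over a char-0 NA field; the located value of the g3 census column, sharp) is a THEOREM (anti-Monge swap descent `sum_perm_lt_sum_rev` + the
Gram–polar identity `det_gram_polarDet_eq_zero`, lift-p1 #15 ✓ p709386 / #16; crit-6 g6 READ #203 docked it inside the V7 bytes).  With it EVERY
calibration target named in this file is kernel (`ValRankOneSharpModularDiss`, `ConvexRung`, `ValCongruenceLemma`, `ValRankOneSharpInj`,
`ValTwoFourCalibration`) and the two located-false ones are refuted by name (`not_valRankOneLaw`, `not_valRankOneSharp`). -/
theorem valTwoFourCalibration_holds : ValTwoFourCalibration :=
  Summit.ValiantsHypothesis.ValiantsHypothesis.Theorems.KPlusLogSqLaw.ValDoor.valTwoFourCalibration_unfolded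

/-- **KERNEL SECTOR ROW (✓ p710733 lift-p1 g22 #17 `…ValuativeDoorSectors`)** — one letter: `det (X^d • M)` is a monomial, 0 edges. -/
theorem genValRootLawAt_one_letter (m : ℕ) : GenValRootLawAt m 1 0 :=
  Summit.ValiantsHypothesis.ValiantsHypothesis.Theorems.KPlusLogSqLaw.ValDoor.genValRootLaw_one_letter_unfolded m

/-- **KERNEL SECTOR ROW (✓ p710733 `…ValuativeDoorSectors`)** — two letters, general matrices: `det (X^a A + X^(a+k) B)` has ≤ m + 1 monomials,
so ≤ m edges (sharp: the K = 2 design row). -/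
theorem genValRootLawAt_two_letters (m : ℕ) : GenValRootLawAt m 2 m :=
  Summit.ValiantsHypothesis.ValiantsHypothesis.Theorems.KPlusLogSqLaw.ValDoor.genValRootLaw_two_letters_unfolded m

/-- **KERNEL SECTOR ROW (✓ p710733 `…ValuativeDoorSectors`)** — width one = valuative Descartes: a K-nomial has ≤ K − 1 Newton edges. -/
theorem genValRootLawAt_width_one (K : ℕ) : GenValRootLawAt 1 K (K - 1) :=
  Summit.ValiantsHypothesis.ValiantsHypothesis.Theorems.KPlusLogSqLaw.ValDoor.genValRootLaw_width_one_unfolded K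

/-- **KERNEL SECTOR ROW (✓ p710733 `…ValuativeDoorSectors`)** — width two, general letters: support ⊆ pair sums, ≤ K(K+1)/2 − 1 edges (NOT sharp
for symmetric letters at K = 4, where `valTwoFourCalibration_holds` gives 8). -/
theorem genValRootLawAt_width_two (K : ℕ) : GenValRootLawAt 2 K (K * (K + 1) / 2 - 1) :=
  Summit.ValiantsHypothesis.ValiantsHypothesis.Theorems.KPlusLogSqLaw.ValDoor.genValRootLaw_width_two_unfolded K

/-- the symmetric two-letter row, through `valRootLawAt_of_gen`. -/
theorem valRootLawAt_two_letters (m : ℕ) : ValRootLawAt m 2 m :=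
  valRootLawAt_of_gen (genValRootLawAt_two_letters m)

/-! ### Skeleton rev 10 — SIDON ROWS (sig-first class: two NEW record defs; no stub byte, no existing def byte; desk R3184 (C)/R3189, crit-6 g7 READ #219/#221)

A support `d : Fin K → ℕ` is SIDON when its pair sums `d l₁ + d l₂` are pairwise distinct (as unordered pairs).  On Sidon supports the `2 × 2`
coefficient classes are singletons or pairs and the m = 2 rows become LINEAR in `K` (lift-p1 g23).  The two defs below are the census rows
`ValRootLawAt` / `GenValRootLawAt` RESTRICTED to Sidon supports (same binders, the Sidon clause inserted after the letters), for every `m`; the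
kernel rows are the `m = 2` instances.  Calibration / record only: consumed by nothing, credit nothing toward 19561 / 18050 / 5069. -/

/-- symmetric valuative census row of format `(m, K)` RESTRICTED TO SIDON SUPPORTS. [record def, skeleton rev 10] -/
def ValSidonRowAt (m K B : ℕ) : Prop :=
  ∀ (F : Type) [Field F] [CharZero F] (v : AbsoluteValue F ℝ), IsNonarchimedean v →
    ∀ (d : Fin K → ℕ) (S : Fin K → Matrix (Fin m) (Fin m) F), (∀ l, (S l).IsSymm) →
      (∀ l₁ l₂ l₃ l₄ : Fin K, d l₁ + d l₂ = d l₃ + d l₄ → (l₁ = l₃ ∧ l₂ = l₄) ∨ (l₁ = l₄ ∧ l₂ = l₃)) →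
        npEdges v (Matrix.det (∑ l, ((Polynomial.X : Polynomial F) ^ d l) • (S l).map Polynomial.C)) ≤ B

/-- general (non-symmetric) valuative census row of format `(m, K)` RESTRICTED TO SIDON SUPPORTS. [record def, skeleton rev 10] -/
def GenValSidonRowAt (m K B : ℕ) : Prop :=
  ∀ (F : Type) [Field F] [CharZero F] (v : AbsoluteValue F ℝ), IsNonarchimedean v →
    ∀ (d : Fin K → ℕ) (M : Fin K → Matrix (Fin m) (Fin m) F),
      (∀ l₁ l₂ l₃ l₄ : Fin K, d l₁ + d l₂ = d l₃ + d l₄ → (l₁ = l₃ ∧ l₂ = l₄) ∨ (l₁ = l₄ ∧ l₂ = l₃)) →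
        npEdges v (Matrix.det (∑ l, ((Polynomial.X : Polynomial F) ^ d l) • (M l).map Polynomial.C)) ≤ B

/-- sanity: a census row gives its Sidon restriction. -/
theorem valSidonRowAt_of_valRootLawAt {m K B : ℕ} (h : ValRootLawAt m K B) : ValSidonRowAt m K B :=
  fun F _ _ v hv d S hS _ => h F v hv d S hS

/-- sanity: the general Sidon row gives the symmetric one. -/
theorem valSidonRowAt_of_gen {m K B : ℕ} (h : GenValSidonRowAt m K B) : ValSidonRowAt m K B :=
  fun F _ _ v hv d S _ hd => h F v hv d S hd

/-- **KERNEL SIDON ROW, symmetric, m = 2, every K (✓ p713933 lift-p1 g23 `…ValuativeDoorSidonTwo.valSidonTwo_unfolded`)** — `npEdges ≤ 3K − 4`: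
two NESTED off-diagonal pairs are never both dominant (`…ValuativeDoorNestedPairs`, ✓ p713439), so the dominant pair sums form a chain and inject
into `[1, 2K − 3]`, plus `K` diagonal sums.  LINEAR in `K`; `K = 4` gives the 8 of `valTwoFourCalibration_holds` (sharp there); equals the tropical
patchwork ceiling `3K − 4` at `m = 2`; sharpness beyond `K = 4` not claimed.  Supersedes, on Sidon supports, the card's «honest m = 2 row»
`v(2,K) ≤ O(K^(7/4))` for dissociated `d`. -/
theorem valSidonRowAt_two (K : ℕ) : ValSidonRowAt 2 K (3 * K - 4) :=
  fun F _ _ v hv d S hS hd => Summit.ValiantsHypothesis.ValiantsHypothesis.Theorems.KPlusLogSqLaw.ValDoor.valSidonTwo_unfolded F v hv K d S hS hd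

/-- **KERNEL SIDON ROW, general letters, m = 2, K ≥ 4 (✓ p713985 lift-p1 g23 `…ValuativeDoorGenTwoSidon.valGenSidonTwo_unfolded`)** —
`npEdges ≤ 5K − 11` (off-diagonal chain `2K − 3` + second chain `2K − 7` + `K − 1`; polarised-determinant Gram singularity
`det_gram_polarDet2_eq_zero`, ✓ p713604 `…GenTwoGram`).  The general width-two row `genValRootLawAt_width_two` gives `K(K+1)/2 − 1` without the
Sidon clause. -/
theorem genValSidonRowAt_two (K : ℕ) (hK : 4 ≤ K) : GenValSidonRowAt 2 K (5 * K - 11) :=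
  fun F _ _ v hv d M hd => Summit.ValiantsHypothesis.ValiantsHypothesis.Theorems.KPlusLogSqLaw.ValDoor.valGenSidonTwo_unfolded F v hv K hK d M hd

/-! ### Skeleton rev 11 — THE NEWTON-POLYGON DICTIONARY (split case) AND THE SIDON ROW IS EXACT AT m = 2
(sig-first class: TWO new record theorem statements; no def byte, no stub byte, no existing block byte)

(1) DICTIONARY.  The skeleton header's «claim to be proved in the first helper file» is kernel in the split case (✓ p716081 lift-p1 g23
`…ValuativeDoorNewtonPolygon.domCount_of_splits`): for `f` split over `F` with `f(0) ≠ 0`, `domCount v f` = 1 + the number of distinct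
absolute values of the roots, i.e. `npEdges v f` = the number of distinct ROOT RADII — the non-archimedean Newton-polygon count that
`ValRootLawAt` / `ValWeakLifting` bound.  (General `f`: pass to a splitting field with an extension of `v`; not needed by any row, not wired.)
(2) SHARPNESS.  lift-p1 g23's explicit family (✓ p714861 `…ValuativeDoorSidonTwoSharp`): `d_i = 2^i`,
`S_i = !![π^((16i+20)·2^i), π^((16i+9)·2^i); π^((16i+9)·2^i), π^(16i·2^i+1)]` over any field carrying a non-archimedean absolute value with
an element `0 < v π < 1` has a Sidon support and at least `3K − 3` dominant coefficient classes (`valSidonTwo_sharp_unfolded`); at the tree's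
2-adic place on `ℝ` (`valSidonTwo_sharp_real`, via `…TwoAdicOnReals`) this refutes every constant below `3K − 4` for `K ≥ 2`.  Together with
`valSidonRowAt_two` (rev 10): v_Sidon(2, K) = 3K − 4 EXACTLY for every `K ≥ 2` — the tropical patchwork ceiling at `m = 2` is attained
valuatively (supersedes rev 10's «sharpness beyond K = 4 not claimed»).  Records only: consumed by nothing, credit nothing toward
19561 / 18050 / 5069. -/

/-- ★ **THE DICTIONARY, split case (✓ p716081 lift-p1 g23 `…ValuativeDoorNewtonPolygon.domCount_of_splits`)**: for a split polynomial with
non-zero constant term, `npEdges v f` is the number of distinct absolute values of its roots. [record theorem, skeleton rev 11] -/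
theorem npEdges_eq_card_rootRadii {F : Type} [Field F] (v : AbsoluteValue F ℝ) (hv : IsNonarchimedean v) (f : Polynomial F)
    (hf : f.Splits) (h0 : f.eval 0 ≠ 0) : npEdges v f = ((f.roots.map v).toFinset).card := by
  unfold npEdges domCount
  rw [Summit.ValiantsHypothesis.ValiantsHypothesis.Theorems.KPlusLogSqLaw.ValDoor.domCount_of_splits v hv f hf h0]
  simp

/-- ★ **THE SIDON ROW AT m = 2 IS SHARP (✓ p714861 lift-p1 g23 `…ValuativeDoorSidonTwoSharp.valSidonTwo_sharp_real`)**: for `K ≥ 2` the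
symmetric Sidon row FAILS with constant `3K − 5`. [record theorem, skeleton rev 11] -/
theorem valSidonRowAt_two_sharp (K : ℕ) (hK : 2 ≤ K) : ¬ ValSidonRowAt 2 K (3 * K - 5) := by
  intro h
  obtain ⟨w, d, S, hw, hS, hd, hcard⟩ := Summit.ValiantsHypothesis.ValiantsHypothesis.Theorems.KPlusLogSqLaw.ValDoor.valSidonTwo_sharp_real K
  have h1 := h ℝ w hw d S hS hd
  unfold npEdges domCount at h1
  omega

/-! ### Skeleton rev 12 — ROOT-RADIUS CURRENCY OF THE CENSUS ROW; THE UNIT-TWO SIDON ROW FORMAT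
(sig-first class: ONE new record def + ONE new record theorem statement + one sanity wire; NO new import, no stub byte, no existing block byte)

(1) With the rev-11 dictionary every census row reads in ROOT currency: under `ValRootLawAt m K B`, a SPLIT symmetric pencil determinant with
non-zero constant term has at most `B` distinct root absolute values (`card_rootRadii_le_of_valRootLawAt`; lift-p1 g23's file F
`…ValuativeDoorSidonTwoRoots` states the m = 2 Sidon instances directly).  This is the form in which vW's conclusion is a statement about ROOTS
of lacunary symmetric determinants over non-archimedean fields — the object the door transfers to `RealRootLawAt`.
(2) lift-p1 g23's G1/G2 (`…ValuativeDoorGenTwoUnitTwo[Law]`): at places with `v 2 = 1` (residue characteristic ≠ 2) the GENERAL width-two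
Sidon row sharpens from `5K − 11` to `4K − 7` (`K ≥ 3`; principal 5 × 5 Gram minor of the polarised determinant, whose reversal passes through
`β(M, M) = 2 det M`).  The def below is that row FORMAT for every `m` (= `GenValSidonRowAt` with the extra hypothesis `v 2 = 1` after
`IsNonarchimedean v`); the kernel row `GenValSidonRowAtUnitTwo 2 K (4K − 7)` is wired BY NAME in a later RE-PIN once G2 is accepted and built.
Records only: consumed by nothing, credit nothing toward 19561 / 18050 / 5069. -/

/-- ★ **ROOT-RADIUS CURRENCY OF THE CENSUS ROW** (rev-11 dictionary `npEdges_eq_card_rootRadii` ← ✓ p716081): under `ValRootLawAt m K B`, a split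
symmetric lacunary pencil determinant with non-zero constant term has at most `B` distinct root absolute values. [record theorem, skeleton rev 12] -/
theorem card_rootRadii_le_of_valRootLawAt {m K B : ℕ} (h : ValRootLawAt m K B) (F : Type) [Field F] [CharZero F]
    (v : AbsoluteValue F ℝ) (hv : IsNonarchimedean v) (d : Fin K → ℕ) (S : Fin K → Matrix (Fin m) (Fin m) F) (hS : ∀ l, (S l).IsSymm)
    (hf : (Matrix.det (∑ l, ((Polynomial.X : Polynomial F) ^ d l) • (S l).map Polynomial.C)).Splits)
    (h0 : (Matrix.det (∑ l, ((Polynomial.X : Polynomial F) ^ d l) • (S l).map Polynomial.C)).eval 0 ≠ 0) :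
    (((Matrix.det (∑ l, ((Polynomial.X : Polynomial F) ^ d l) • (S l).map Polynomial.C)).roots.map v).toFinset).card ≤ B := by
  have h1 := h F v hv d S hS
  rwa [npEdges_eq_card_rootRadii v hv _ hf h0] at h1

/-- general (non-symmetric) valuative census row of format `(m, K)` RESTRICTED TO SIDON SUPPORTS, AT PLACES WITH `v 2 = 1`
(residue characteristic ≠ 2). [record def, skeleton rev 12] -/
def GenValSidonRowAtUnitTwo (m K B : ℕ) : Prop :=
  ∀ (F : Type) [Field F] [CharZero F] (v : AbsoluteValue F ℝ), IsNonarchimedean v → v 2 = 1 →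
    ∀ (d : Fin K → ℕ) (M : Fin K → Matrix (Fin m) (Fin m) F),
      (∀ l₁ l₂ l₃ l₄ : Fin K, d l₁ + d l₂ = d l₃ + d l₄ → (l₁ = l₃ ∧ l₂ = l₄) ∨ (l₁ = l₄ ∧ l₂ = l₃)) →
        npEdges v (Matrix.det (∑ l, ((Polynomial.X : Polynomial F) ^ d l) • (M l).map Polynomial.C)) ≤ B

/-- sanity: the general Sidon row gives its unit-two restriction. -/
theorem genValSidonRowAtUnitTwo_of_gen {m K B : ℕ} (h : GenValSidonRowAt m K B) : GenValSidonRowAtUnitTwo m K B :=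
  fun F _ _ v hv _ d M hd => h F v hv d M hd

/-! ### Skeleton rev 13 — THE GENERAL WIDTH-TWO SIDON ROW IS 4K − 7 EXACT AWAY FROM RESIDUE CHARACTERISTIC 2
(val-idea-24 g5; RE-PIN part: one import + one `_two` wire into the rev-12 record def `GenValSidonRowAtUnitTwo`;
SIG-FIRST part: one import + ONE new record theorem statement `genValSidonRowAt_two_sharp`; no def byte, no stub byte, no existing block byte)

Calibration rows of the m = 2 valuative census, general (non-symmetric) letters on Sidon supports — consumed by nothing, credit nothing toward
vW / 19561 / 18050 / 5069.  Table of record after this rev (m = 2, K letters, Sidon support): symmetric letters `3K − 4` EXACT (rev 10/11);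
general letters `≤ 5K − 11` at every non-archimedean place (rev 10), `≥ 4K − 7` at every non-archimedean place (this rev, (b)), and
`≤ 4K − 7` hence EXACT at places with `v 2 = 1` (this rev, (a)); at places with `v 2 < 1` (e.g. the 2-adic place of `ℝ`) the window
`[4K − 7, 5K − 11]` stays open. -/

/-- **(a) KERNEL UNIT-TWO SIDON ROW, general letters, m = 2, K ≥ 3 (✓ p718764 lift-p1 g23 `…ValuativeDoorGenTwoUnitTwoLaw.valGenSidonTwo_unitTwo_unfolded`)**
— at places with `v 2 = 1`: `npEdges ≤ 4K − 7` (no three pairwise nested dominant off-diagonal pairs and no dominant diagonal exponent strictly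
inside the inner pair of two nested dominant pairs, two-copy count `(2K − 1) + (2K − 5)`; residue characteristic 2 not covered — there the row
is `genValSidonRowAt_two`'s `5K − 11`). [record wire, skeleton rev 13] -/
theorem genValSidonRowAtUnitTwo_two (K : ℕ) (hK : 3 ≤ K) : GenValSidonRowAtUnitTwo 2 K (4 * K - 7) :=
  fun F _ _ v hv h2 d M hd => Summit.ValiantsHypothesis.ValiantsHypothesis.Theorems.KPlusLogSqLaw.ValDoor.valGenSidonTwo_unitTwo_unfolded F v hv h2 K hK d M hd

/-- ★ **(b) THE GENERAL WIDTH-TWO SIDON ROW FAILS WITH CONSTANT 4K − 8 (✓ p720037 lift-p1 g23 `…ValuativeDoorGenTwoSharp.valGenSidonTwo_sharp_real`)**: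
for `K ≥ 2`, at the 2-adic place of `ℝ` the explicit two-staircase family `d_i = 2^i`,
`M_i = [[π^((32i+64)2^i), π^((32i+104)2^i)], [π^((32i+29)2^i), π^((32i+43)2^i)]]` has `≥ 4K − 6` dominant exponents, i.e. `npEdges ≥ 4K − 7`
(the same family works at EVERY non-archimedean place, `valGenSidonTwo_sharp_unfolded`).  With (a): the general Sidon row at m = 2 is
`4K − 7` EXACT at places with `v 2 = 1`. [record theorem, skeleton rev 13] -/
theorem genValSidonRowAt_two_sharp (K : ℕ) (hK : 2 ≤ K) : ¬ GenValSidonRowAt 2 K (4 * K - 8) := by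
  intro h
  obtain ⟨w, d, M, hw, hd, hcard⟩ := Summit.ValiantsHypothesis.ValiantsHypothesis.Theorems.KPlusLogSqLaw.ValDoor.valGenSidonTwo_sharp_real K
  have h1 := h ℝ w hw d M hd
  unfold npEdges domCount at h1
  omega

/-! ### Skeleton rev 14 — OFF SIDON SUPPORTS THE m = 2 VALUATIVE ROW EXCEEDS 3K − 4: `¬ ValRootLawAt 2 5 12`
(val-idea-24 g5; SIG-FIRST: one import + ONE new record theorem statement `valRootLawAt_two_five_sharp`; no def byte, no stub byte, no existing block byte)

Record row of the m = 2 valuative census (UNRESTRICTED supports), consumed by nothing, credits nothing toward vW / 19561 / 18050 / 5069: the Sidon row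
`3K − 4` (rev 10/11, EXACT on Sidon supports) is a SUPPORT-CLASS law — at the non-Sidon support `(0, 3, 4, 8, 14)` (`0 + 8 = 4 + 4`) explicit symmetric
`2 × 2` letters carry `14` dominant exponents, so `npEdges = 13 > 11 = 3·5 − 4` and `ValRootLawAt 2 5 B` needs `B ≥ 13` (desk R3271: «THE SIDON HYPOTHESIS IS
NECESSARY»; v(2,5) ≥ 13 unrestricted, KERNEL). -/

/-- **KERNEL NON-SIDON ROW, m = 2, K = 5 (✓ p721147 lift-p1 g23 `…ValuativeDoorNonSidonWitness.valNonSidonFive_rat`)** — over `ℚ` at the 3-adic place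
(`v 2 = 1`, `v 3 < 1`, `…NonSidonPrelims.threeAdicRat_unfolded`) the support `(0, 3, 4, 8, 14)` carries a symmetric pencil with `≥ 14` dominant exponents, hence
`¬ ValRootLawAt 2 5 12`.  Record only (a settled lower edge of the unrestricted m = 2 row); by name, as lift-p1's dock `DockNonSidon.lean`. -/
theorem valRootLawAt_two_five_sharp : ¬ ValRootLawAt 2 5 12 := by
  intro h
  obtain ⟨w, d, S, hw, -, hS, hcard⟩ := Summit.ValiantsHypothesis.ValiantsHypothesis.Theorems.KPlusLogSqLaw.ValDoor.valNonSidonFive_rat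
  have h1 := h ℚ w hw d S hS
  unfold npEdges domCount at h1
  omega

/-! ### Skeleton rev 15 — THE PROGRESSION-FREE ROW IS THE SIDON ROW `3K − 4` ON EVERY SUPPORT; THE `f·g + 1` DICTIONARY
(val-idea-24 g5; RE-PIN class per crit-6 g8 READ #274–#276 / desk R3313: imports + record theorem statements proved BY NAME from lift-p1 g24's
ACCEPTED files ✓ p724718 · p724798 · p726156 · p726162 · p726253; no def byte, no stub byte, no existing block byte)

Record rows of the m = 2 valuative census, consumed by nothing, crediting nothing toward vW / 19561 / 18050 / 5069.  Rev 10/11: the Sidon row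
`npEdges ≤ 3K − 4` is EXACT on Sidon supports; rev 14: OFF Sidon supports the unrestricted row exceeds it (`¬ ValRootLawAt 2 5 12`, support
`(0, 3, 4, 8, 14)` with the progression `0 + 8 = 4 + 4`).  Rev 15 localises the excess (lift-p1 g24, ✓ p723906 `…ValuativeDoorSweep`, ✓ p724718
`…ValuativeDoorProgressionFree`): by the ultrametric SWEEP `Dom(a d − b c) ⊆ Dom(a d) ∪ Dom(b c)` whenever the tied leading binomials are
cancellation-free, the Sidon value `3K − 4` holds on EVERY injective support as soon as the binomials `a_x c_y − b_z²` on the THREE-TERM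
PROGRESSIONS `d_x + d_y = 2 d_z` of the support do not cancel — all super-Sidon growth of the unrestricted m = 2 row lives on cancelling
progressions / valuatively singular letters (desk R3313 ★★★ «THE PROGRESSION-FREE ROW IS THE SIDON ROW»).  And the DICTIONARY (✓ p724798
`…ValuativeDoorFGPlusOne`): `det Σ_l X^{d_l} !![p_l, δ_{l l₀}; δ_{l l₀}, −q_l] = −(f g + 1)` for `f = Σ p_l X^{d_l}`, `g = Σ q_l X^{d_l}`, `d l₀ = 0`, so the
symmetric width-two row bounds the Newton polygon of `f g + 1` on a common `K`-support containing `0` — the valuative twin of the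
Koiran–Portier–Tavenas–Thomassé `Newt(fg + 1)` question (FoCM 2015, arXiv:1308.2286, Appendix); «is v(2, K) linear in K?» is at least as hard as
that question's width-two case (lift-p1 g24 memo `WIDTH-TWO-STRUCTURE-liftp1g24.md`).  The statements below insert the extra hypotheses into the
binder list of `ValRootLawAt 2 K _` / `ValSidonRowAt 2 K _` verbatim (the kernel theorems carry no characteristic hypothesis; `[CharZero F]` is
kept only for census conformity and is unused). -/

/-- **KERNEL PROGRESSION-FREE ROW, symmetric, m = 2, every K, every support (✓ p724718 lift-p1 g24
`…ValuativeDoorProgressionFree.valProgressionFree_unfolded`)** — on an injective support, if every AP-binomial `a_{l₁} c_{l₂} − b_{l₃}²`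
(`d_{l₁} + d_{l₂} = 2 d_{l₃}`, the letter case `l₁ = l₂ = l₃` included) is cancellation-free then `npEdges ≤ 3K − 4`, the Sidon value. -/
theorem valProgressionFreeRow_two (K : ℕ) :
    ∀ (F : Type) [Field F] [CharZero F] (v : AbsoluteValue F ℝ), IsNonarchimedean v →
      ∀ (d : Fin K → ℕ) (S : Fin K → Matrix (Fin 2) (Fin 2) F), (∀ l, (S l).IsSymm) → Function.Injective d →
        (∀ l₁ l₂ l₃ : Fin K, d l₁ + d l₂ = d l₃ + d l₃ →
          v (S l₁ 0 0 * S l₂ 1 1 - S l₃ 0 1 * S l₃ 0 1) = max (v (S l₁ 0 0 * S l₂ 1 1)) (v (S l₃ 0 1 * S l₃ 0 1))) →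
        npEdges v (Matrix.det (∑ l, ((Polynomial.X : Polynomial F) ^ d l) • (S l).map Polynomial.C)) ≤ 3 * K - 4 :=
  fun F _ _ v hv d S hS hd hfree => Summit.ValiantsHypothesis.ValiantsHypothesis.Theorems.KPlusLogSqLaw.ValDoor.valProgressionFree_unfolded F v hv K d S hS hd hfree

/-- **KERNEL AP-FREE-SUPPORT ROW, symmetric, m = 2, every K (✓ p724718 `…ValuativeDoorProgressionFree.valAPFreeSupport_unfolded`)** — on a
support WITHOUT three-term progressions it suffices that each letter is valuatively nonsingular (`v(a_l c_l − b_l²) = max(v(a_l c_l), v(b_l²))`):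
`npEdges ≤ 3K − 4` whatever the four-term coincidences `d_x + d_y = d_z + d_w` — the Sidon clause of `valSidonRowAt_two` is needed only on
progressions. -/
theorem valAPFreeSupportRow_two (K : ℕ) :
    ∀ (F : Type) [Field F] [CharZero F] (v : AbsoluteValue F ℝ), IsNonarchimedean v →
      ∀ (d : Fin K → ℕ) (S : Fin K → Matrix (Fin 2) (Fin 2) F), (∀ l, (S l).IsSymm) →
        (∀ l₁ l₂ l₃ : Fin K, d l₁ + d l₂ = d l₃ + d l₃ → l₁ = l₃ ∧ l₂ = l₃) →
        (∀ l : Fin K, v (S l 0 0 * S l 1 1 - S l 0 1 * S l 0 1) = max (v (S l 0 0 * S l 1 1)) (v (S l 0 1 * S l 0 1))) →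
        npEdges v (Matrix.det (∑ l, ((Polynomial.X : Polynomial F) ^ d l) • (S l).map Polynomial.C)) ≤ 3 * K - 4 :=
  fun F _ _ v hv d S hS hap hns => Summit.ValiantsHypothesis.ValiantsHypothesis.Theorems.KPlusLogSqLaw.ValDoor.valAPFreeSupport_unfolded F v hv K d S hS hap hns

/-- **THE WIDTH-TWO ROW BOUNDS `Newt(f g + 1)` (✓ p724798 lift-p1 g24 `…ValuativeDoorFGPlusOne.valRow_two_fg_add_one_unfolded`)** — any bound `B`
for the symmetric valuative row of format `(2, K)` bounds the number of Newton-polygon edges of `f g + 1` for all `f, g` on a common `K`-support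
containing `0`.  Dictionary only; with `valRootLawAt_two_five_sharp` / `valSidonRowAt_two` it places «v(2, K) linear?» beside the KPTT question. -/
theorem valRootLawAt_two_fg_add_one {K B : ℕ} (h : ValRootLawAt 2 K B) :
    ∀ (F : Type) [Field F] [CharZero F] (v : AbsoluteValue F ℝ), IsNonarchimedean v →
      ∀ (d : Fin K → ℕ) (l₀ : Fin K), d l₀ = 0 → ∀ (p q : Fin K → F),
        npEdges v ((∑ l, Polynomial.C (p l) * (Polynomial.X : Polynomial F) ^ d l) *
            (∑ l, Polynomial.C (q l) * (Polynomial.X : Polynomial F) ^ d l) + 1) ≤ B :=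
  fun F _ _ v hv d l₀ h0 p q => Summit.ValiantsHypothesis.ValiantsHypothesis.Theorems.KPlusLogSqLaw.ValDoor.valRow_two_fg_add_one_unfolded F v hv K B (h F v hv) d l₀ h0 p q

/-- **`f g + 1` OBEYS THE SIDON ROW UNLESS ITS CONSTANT TERM CANCELS (✓ p726156 lift-p1 g24 `…ValuativeDoorFGPlusOneSidon.valFGPlusOne_sidon_unfolded`)** —
on an injective common `K`-support containing `0`, if `v(p_{l₀} q_{l₀} + 1) = max(v(p_{l₀} q_{l₀}), 1)` then `npEdges_v(f g + 1) ≤ 3K − 4`: the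
valuative form of KPTT's dichotomy («the difficult case appears when the constant term of `fg` equals `−1`»), with no convexity condition on the
support; the difficult case is exactly one valuatively SINGULAR letter `!![p_{l₀}, 1; 1, −q_{l₀}]`. -/
theorem valFGPlusOneSidonRow_two (K : ℕ) :
    ∀ (F : Type) [Field F] [CharZero F] (v : AbsoluteValue F ℝ), IsNonarchimedean v →
      ∀ (d : Fin K → ℕ), Function.Injective d → ∀ (l₀ : Fin K), d l₀ = 0 → ∀ (p q : Fin K → F),
        v (p l₀ * q l₀ + 1) = max (v (p l₀ * q l₀)) 1 →
        npEdges v ((∑ l, Polynomial.C (p l) * (Polynomial.X : Polynomial F) ^ d l) *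
            (∑ l, Polynomial.C (q l) * (Polynomial.X : Polynomial F) ^ d l) + 1) ≤ 3 * K - 4 :=
  fun F _ _ v hv d hd l₀ h0 p q hc => Summit.ValiantsHypothesis.ValiantsHypothesis.Theorems.KPlusLogSqLaw.ValDoor.valFGPlusOne_sidon_unfolded F v hv K d hd l₀ h0 p q hc

/-- **KERNEL COINCIDENCE-FREE ROW, general `2 × 2` letters, m = 2, every K (✓ p726162 lift-p1 g24 `…ValuativeDoorCoincidenceFree.valCoincidenceFree_unfolded`)**
— on an injective support, if every coincidence binomial `a_{l₁} δ_{l₂} − b_{l₃} γ_{l₄}` (`d_{l₁} + d_{l₂} = d_{l₃} + d_{l₄}`) is cancellation-free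
then `Dom(det) ⊆ Dom(a δ) ∪ Dom(b γ)`: `npEdges ≤ 4K − 3` in EVERY residue characteristic (the general Sidon rows are `4K − 7` for `v 2 = 1`,
`genValSidonRowAtUnitTwo_two`, and `5K − 11` in general, `genValSidonRowAt_two`; not sharp).  Binders = those of `GenValRootLawAt 2 K _` with
injectivity and the cancellation clause inserted. -/
theorem valCoincidenceFreeRow_two (K : ℕ) :
    ∀ (F : Type) [Field F] [CharZero F] (v : AbsoluteValue F ℝ), IsNonarchimedean v →
      ∀ (d : Fin K → ℕ) (M : Fin K → Matrix (Fin 2) (Fin 2) F), Function.Injective d →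
        (∀ l₁ l₂ l₃ l₄ : Fin K, d l₁ + d l₂ = d l₃ + d l₄ →
          v (M l₁ 0 0 * M l₂ 1 1 - M l₃ 0 1 * M l₄ 1 0) = max (v (M l₁ 0 0 * M l₂ 1 1)) (v (M l₃ 0 1 * M l₄ 1 0))) →
        npEdges v (Matrix.det (∑ l, ((Polynomial.X : Polynomial F) ^ d l) • (M l).map Polynomial.C)) ≤ 4 * K - 3 :=
  fun F _ _ v hv d M hd hfree => Summit.ValiantsHypothesis.ValiantsHypothesis.Theorems.KPlusLogSqLaw.ValDoor.valCoincidenceFree_unfolded F v hv K d M hd hfree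

/-- **KERNEL PROGRESSION-FREE ROW FOR AN ARBITRARY SUPPORT MAP (✓ p726253 lift-p1 g24 `…ValuativeDoorProgressionFreePoly.valProgressionFreeMerged_unfolded`)**
— `d : Fin K → ℕ` not necessarily injective, the progression hypothesis placed on the MERGED letters (the coefficients of the entry polynomials
`Σ_l S_l X^{d_l}`): `npEdges ≤ 3K − 4`.  Exactly the binders of `ValRootLawAt 2 K (3K − 4)` plus one coefficient-level clause — the record row
with no side condition on the support (letter-free count `card_dominant_symm_poly_le`: `#Dom(a c − b²) ≤ (2|E| − 3) + |E|`). -/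
theorem valProgressionFreeMergedRow_two (K : ℕ) :
    ∀ (F : Type) [Field F] [CharZero F] (v : AbsoluteValue F ℝ), IsNonarchimedean v →
      ∀ (d : Fin K → ℕ) (S : Fin K → Matrix (Fin 2) (Fin 2) F), (∀ l, (S l).IsSymm) →
        (∀ x y z : ℕ, x + y = z + z →
          v ((∑ l, Polynomial.C (S l 0 0) * (Polynomial.X : Polynomial F) ^ d l).coeff x *
                (∑ l, Polynomial.C (S l 1 1) * (Polynomial.X : Polynomial F) ^ d l).coeff y
              - (∑ l, Polynomial.C (S l 0 1) * (Polynomial.X : Polynomial F) ^ d l).coeff z *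
                (∑ l, Polynomial.C (S l 0 1) * (Polynomial.X : Polynomial F) ^ d l).coeff z)
            = max (v ((∑ l, Polynomial.C (S l 0 0) * (Polynomial.X : Polynomial F) ^ d l).coeff x *
                      (∑ l, Polynomial.C (S l 1 1) * (Polynomial.X : Polynomial F) ^ d l).coeff y))
                (v ((∑ l, Polynomial.C (S l 0 1) * (Polynomial.X : Polynomial F) ^ d l).coeff z *
                      (∑ l, Polynomial.C (S l 0 1) * (Polynomial.X : Polynomial F) ^ d l).coeff z))) →
        npEdges v (Matrix.det (∑ l, ((Polynomial.X : Polynomial F) ^ d l) • (S l).map Polynomial.C)) ≤ 3 * K - 4 :=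
  fun F _ _ v hv d S hS hfree => Summit.ValiantsHypothesis.ValiantsHypothesis.Theorems.KPlusLogSqLaw.ValDoor.valProgressionFreeMerged_unfolded F v hv K d S hS hfree

/-! ### Skeleton rev 16 — THE AP-FREE LAW: supports without three-term progressions obey the Sidon row `3K − 4`, all letters
(val-idea-24 g5; RE-PIN class pre-registered by desk g33 R3340 (5), custodian val-idea-crit-6 g9: one import + one record theorem proved BY NAME from
lift-p1 g25's ACCEPTED file ✓ p731207 `…ValuativeDoorAPFreeLaw`; no def byte, no stub byte; the only existing byte touched is crit-6's prose nit in the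
rev-15 docblock, ★★ → ★★★)

Rev 15 recorded the AP-free-SUPPORT row under the extra hypothesis that every letter is valuatively nonsingular (`valAPFreeSupportRow_two`) and
named the singular-letter residual as the open half of the AP-free conjecture (lift-p1 g24 memo §3).  lift-p1 g25 closed it (paper 15:11Z, kernel
✓ `…ValuativeDoorRoofEngine` · ✓ `…ValuativeDoorRoofExcess` · ✓ p731207 `…ValuativeDoorAPFreeLaw`; mechanism: MAX-EXCESS PROPAGATION on the polarised Gram
minors under a concave two-slope roof): on a support WITHOUT three-term progressions EVERY symmetric 2 × 2 pencil over a non-archimedean field —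
singular letters included — has `npEdges ≤ 3K − 4`, the Sidon value; sharp (`valSidonRowAt_two_sharp`), and the AP-free hypothesis cannot be dropped
(`valRootLawAt_two_five_sharp`: support `(0, 3, 4, 8, 14)`, progression `0 + 8 = 4 + 4`, thirteen edges).  So at width two the super-Sidon content of
the unrestricted valuative row lives EXACTLY on supports with three-term progressions.  Record row, consumed by nothing, zero credit toward vW /
19561 / 18050 / 5069; `[CharZero F]` unused, kept for census conformity. -/

/-- **THE AP-FREE LAW, symmetric, m = 2, every K (✓ p731207 lift-p1 g25 `…ValuativeDoorAPFreeLaw.valAPFree_unfolded`)** — `valAPFreeSupportRow_two`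
with the nonsingular-letter hypothesis DELETED: no three-term progression in the support ⇒ `npEdges ≤ 3K − 4`. -/
theorem valAPFreeRow_two (K : ℕ) :
    ∀ (F : Type) [Field F] [CharZero F] (v : AbsoluteValue F ℝ), IsNonarchimedean v →
      ∀ (d : Fin K → ℕ) (S : Fin K → Matrix (Fin 2) (Fin 2) F), (∀ l, (S l).IsSymm) →
        (∀ l₁ l₂ l₃ : Fin K, d l₁ + d l₂ = d l₃ + d l₃ → l₁ = l₃ ∧ l₂ = l₃) →
        npEdges v (Matrix.det (∑ l, ((Polynomial.X : Polynomial F) ^ d l) • (S l).map Polynomial.C)) ≤ 3 * K - 4 :=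
  fun F _ _ v hv d S hS hap => Summit.ValiantsHypothesis.ValiantsHypothesis.Theorems.KPlusLogSqLaw.ValDoor.valAPFree_unfolded F v hv K d S hS hap

/-! ### Skeleton rev 17 — THE TAME-PROGRESSION LAW: on every injective support the width-two symmetric row exceeds the Sidon value only through a CANCELLING progression class
(val-idea-24 g5; RE-PIN class pre-described by desk g33 R3352 (3)(a) «V17 = `valTameProgressionRow_two (K)` := ✓#7 `valProgressionTame_unfolded`
re-binderised (one import + one wire)», custodian of record = desk g33 after val-idea-crit-6 g9's close; one import + one record theorem proved BY NAME
from lift-p1 g25's ACCEPTED file ✓ p732654 `…ValuativeDoorTameLaw`; no def byte, no stub byte, no existing byte touched)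

Rev 16 recorded the AP-FREE LAW (`valAPFreeRow_two`: no three-term progression ⇒ `npEdges ≤ 3K − 4`, all letters).  lift-p1 g25's last series
(✓ `…ValuativeDoorTameEngine` · ✓ `…TameRoof` · ✓ `…TameNested` · ✓ p732654 `…TameLaw`) replaces the GLOBAL hypothesis «no progression» by the
LOCAL one «every progression class is TAME»: for every three-term-progression class `2 d_z = d_x + d_w` (`x ≠ w`) the letter determinant
`det S_z` and the polarised Gram entry `G_xw = a_x c_w + a_w c_x − 2 b_x b_w` are `v`-bounded by the class coefficient `f_(2 d_z)` (the class does
not cancel at its top).  Then, on EVERY injective support and for ALL symmetric letters, `npEdges ≤ 3K − 4`.  This is the width-two dichotomy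
of record as ONE kernel statement: the symmetric width-two valuative row exceeds the Sidon value `3K − 4` ONLY through a cancelling
progression class (`valRootLawAt_two_five_sharp`: `(0, 3, 4, 8, 14)`, class `8 = 0 + 8 = 4 + 4`, thirteen edges); `valAPFreeRow_two` is the
vacuous case and `valSidonRowAt_two` the Sidon case.  Record row, consumed by nothing, zero credit toward vW / 19561 / 18050 / 5069;
`[CharZero F]` unused, kept for census conformity. -/

/-- **THE TAME-PROGRESSION LAW, symmetric, m = 2, every K (✓ p732654 lift-p1 g25 `…ValuativeDoorTameLaw.valProgressionTame_unfolded`)** —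
injective support, every progression class `d x + d w = d z + d z` (`x ≠ w`) tame ⇒ `npEdges ≤ 3K − 4`. -/
theorem valTameProgressionRow_two (K : ℕ) :
    ∀ (F : Type) [Field F] [CharZero F] (v : AbsoluteValue F ℝ), IsNonarchimedean v →
      ∀ (d : Fin K → ℕ) (S : Fin K → Matrix (Fin 2) (Fin 2) F), (∀ l, (S l).IsSymm) → Function.Injective d →
        (∀ z x w : Fin K, x ≠ w → d x + d w = d z + d z →
          v (S z 0 0 * S z 1 1 - S z 0 1 * S z 0 1) ≤ v ((Matrix.det (∑ l, ((Polynomial.X : Polynomial F) ^ d l) • (S l).map Polynomial.C)).coeff (d z + d z)) ∧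
            v (S x 0 0 * S w 1 1 + S w 0 0 * S x 1 1 - 2 * S x 0 1 * S w 0 1) ≤ v ((Matrix.det (∑ l, ((Polynomial.X : Polynomial F) ^ d l) • (S l).map Polynomial.C)).coeff (d z + d z))) →
        npEdges v (Matrix.det (∑ l, ((Polynomial.X : Polynomial F) ^ d l) • (S l).map Polynomial.C)) ≤ 3 * K - 4 :=
  fun F _ _ v hv d S hS hinj hT => Summit.ValiantsHypothesis.ValiantsHypothesis.Theorems.KPlusLogSqLaw.ValDoor.valProgressionTame_unfolded F v hv K d S hS hinj hT

end Summit.ValiantsHypothesis.ValiantsHypothesis.Cruxes.WeakLifting.ValDoor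

end
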